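import Literature.Probability.RandomPlanarGeometry.BDGS2012GrahamAlgebra
import HarnessLib

/-!
# Graham's Borel-type bound for `z_c(d)` (BDGS 2012, (1.20)), XIV: the induction of Graham §6
# and the discharge of `BDGS2012_Graham_criticalPoint_bound`

Sibling file of `Literature.Probability.RandomPlanarGeometry.BDGS2012` (fact
`BDGS2012_Graham_criticalPoint_bound` = Graham 2010, Theorem 1), last of the series
`BDGS2012GrahamReversion` … `BDGS2012GrahamAlgebra`. The printed proof (Graham 2010, §6) works at
finite memory `τ = 2M` and imports Kesten's bound on `|μ - μ_τ|`; here the whole argument is run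
at `τ = ∞` on top of the tree's converged lace expansion (Slade 2006, Theorem 5.1): the term `A₁`
disappears, the types `N ≥ M + 1` and the lengths `a ≥ 2M` are the terms `A₂, A₃` (with the lace
graphs having a piece longer than `K₀ ≍ d` estimated by the marking inequality and the uniform bound
on `H_z^{*(p+1)}`), and `A₄` is handled by the reversion algebra of `BDGS2012GrahamAlgebra.lean`.

## What the source prints (Graham 2010, Theorem 1 and §6)

"Writing the asymptotic expansion of `z_c` as `Σ_{i=1}^∞ αᵢ(2d)^{-i}`, there is a constant `C`,
independent of `d` and `M`, such that for each `M` and for all `d ≥ 1`,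
`|z_c - Σ_{i=1}^{M-1} αᵢ/(2d)^i| ≤ C^M M!/(2d)^M`." §6: "for `s ≥ C₅/M`, inequality (SAWboundEqn)
holds simply by Lemma 3. We will show by induction that for some constants `C₅` and `C₆`, for
`k = 1, 2, …` and `s ≤ C₅/k`, `β = Σ_{n=1}^{k-1} αₙ sⁿ + E_k s^k` with `|E_k| ≤ C₆^k k!`."

## What is formalised

* `exists_highDim_package` — the high-dimensional inputs in one `∀ᶠ d`: the type bounds
  `(c₀/d)^N` on `[0, z_c]`, `2d z_c ≤ 1 + C_b/d`, and for `0 < z < z_c` the bootstrap inequalities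
  with `K ≤ 2`, the absolute convergence of the expansion and `‖Π_z‖₁ ≤ 1`;
* the induction step `graham_step` and the induction `graham_induction` (claim (C8) at `τ = ∞`),
  the trivial regime `graham_trivial`, and
* **`BDGS2012_Graham_criticalPoint_bound_holds`** with `α = alpha grahamC`.
-/

noncomputable section

open Finset Filter Topology MeasureTheory
open scoped BigOperators ENNReal
open Literature.Probability.LatticeModels Literature.Probability.LatticeModels.SRW
open Literature.Barriers.CriticalPhenomena Literature.Barriers.CriticalPhenomena.SAWLace
open Literature.Probability.RandomPlanarGeometry.LaceExpansion (laceCoeff lacePi)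

namespace Literature.Probability.RandomPlanarGeometry.SAW.Zd.Graham2010

variable {d : ℕ}

/-! ### `‖Π_z‖₁` from the type bounds -/

/-- `|Π_z(x)| ≤ Σ_m |π_m(x)| z^m` under absolute convergence. [folklore] -/
theorem abs_lacePi_le_tsum {z : ℝ} (hz : 0 ≤ z)
    (hπ : Summable fun q : ℕ × Site d => |laceCoeff d 1 q.1 q.2| * z ^ q.1) (x : Site d) :
    |lacePi d 1 z x| ≤ ∑' m : ℕ, |laceCoeff d 1 m x| * z ^ m := by
  have hπ' : Summable fun q : Site d × ℕ => |laceCoeff d 1 q.2 q.1| * z ^ q.2 :=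
    (Equiv.prodComm (Site d) ℕ).summable_iff.2 hπ
  have hnn : ∀ q : Site d × ℕ, 0 ≤ |laceCoeff d 1 q.2 q.1| * z ^ q.2 := fun q => by positivity
  obtain ⟨h1, -⟩ := (summable_prod_of_nonneg hnn).1 hπ'
  have hs : Summable fun m => laceCoeff d 1 m x * z ^ m :=
    Summable.of_norm_bounded (h1 x) fun m => by rw [Real.norm_eq_abs, abs_mul, abs_pow, abs_of_nonneg hz]
  calc |lacePi d 1 z x| = ‖∑' m, laceCoeff d 1 m x * z ^ m‖ := (Real.norm_eq_abs _).symm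
    _ ≤ ∑' m, ‖laceCoeff d 1 m x * z ^ m‖ := norm_tsum_le_tsum_norm hs.norm
    _ = ∑' m, |laceCoeff d 1 m x| * z ^ m :=
        tsum_congr fun m => by rw [Real.norm_eq_abs, abs_mul, abs_pow, abs_of_nonneg hz]

/-- In the good regime, `Σ_x Π_z^{(M+1)}(x) ≤ (c₀/d)^{M+1}` in `[0,∞]`. [folklore] -/
theorem tsum_piGen_le_ofReal {c₀ : ℝ}
    (h : ∀ (M A : ℕ) (z : ℝ), 0 ≤ z → z ≤ criticalPoint d →
      ∑ a ∈ Finset.range (A + 1), (diagTotal d a M : ℝ) * z ^ a ≤ (c₀ / d) ^ (M + 1))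
    {z : ℝ} (hz0 : 0 ≤ z) (hzc : z ≤ criticalPoint d) (M : ℕ) :
    ∑' x : Site d, piGen d z M x ≤ ENNReal.ofReal ((c₀ / d) ^ (M + 1)) := by
  rw [tsum_piGen_eq]
  refine ENNReal.tsum_le_of_sum_range_le fun A => ?_
  rcases A with _ | A
  · simp
  have heq : ∑ a ∈ Finset.range (A + 1), (diagTotal d a M : ℝ≥0∞) * ENNReal.ofReal z ^ a =
      ENNReal.ofReal (∑ a ∈ Finset.range (A + 1), (diagTotal d a M : ℝ) * z ^ a) := by
    rw [ENNReal.ofReal_sum_of_nonneg fun a _ => by positivity]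
    refine Finset.sum_congr rfl fun a _ => ?_
    rw [ENNReal.ofReal_mul (by positivity), ENNReal.ofReal_natCast, ENNReal.ofReal_pow hz0]
  rw [heq]
  exact ENNReal.ofReal_le_ofReal (h M A z hz0 hzc)

/-- **`‖Π_z‖₁ ≤ 2c₀/d`** in the good regime (`c₀/d ≤ 1/2`), for `0 ≤ z ≤ z_c`.
[cite: BDGS2012, §5.4 (`‖Π_z‖₁ ≤ cd⁻¹`)] -/
theorem tsum_abs_lacePi_le {c₀ : ℝ} (hc₀ : 0 < c₀) (hr : c₀ / d ≤ 1 / 2)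
    (h : ∀ (M A : ℕ) (z : ℝ), 0 ≤ z → z ≤ criticalPoint d →
      ∑ a ∈ Finset.range (A + 1), (diagTotal d a M : ℝ) * z ^ a ≤ (c₀ / d) ^ (M + 1))
    {z : ℝ} (hz0 : 0 ≤ z) (hzc : z ≤ criticalPoint d) :
    ∑' x : Site d, |lacePi d 1 z x| ≤ 2 * (c₀ / d) := by
  set r := c₀ / d with hr'
  have hr0 : 0 ≤ r := by rw [hr']; positivity
  have hπ : Summable fun q : ℕ × Site d => |laceCoeff d 1 q.1 q.2| * z ^ q.1 :=
    summable_abs_laceCoeff_of_ne_top hz0 (tsum_tsum_piGen_ne_top hc₀ hr h hz0 hzc)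
  -- `Σ_x |Π_z(x)| ≤ Σ_{(m,x)} |π_m(x)| z^m =: L`
  have hπ' : Summable fun q : Site d × ℕ => |laceCoeff d 1 q.2 q.1| * z ^ q.2 :=
    (Equiv.prodComm (Site d) ℕ).summable_iff.2 hπ
  have hL : ∑' x : Site d, |lacePi d 1 z x| ≤ ∑' q : ℕ × Site d, |laceCoeff d 1 q.1 q.2| * z ^ q.1 := by
    have hsum_x : Summable fun x : Site d => ∑' m : ℕ, |laceCoeff d 1 m x| * z ^ m := hπ'.prod
    calc ∑' x : Site d, |lacePi d 1 z x| ≤ ∑' x : Site d, ∑' m : ℕ, |laceCoeff d 1 m x| * z ^ m := by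
          refine Summable.tsum_le_tsum (abs_lacePi_le_tsum hz0 hπ) ?_ hsum_x
          exact (summable_abs_lacePi hz0 hπ)
      _ = ∑' q : Site d × ℕ, |laceCoeff d 1 q.2 q.1| * z ^ q.2 := (hπ'.tsum_prod).symm
      _ = ∑' q : ℕ × Site d, |laceCoeff d 1 q.1 q.2| * z ^ q.1 :=
          (Equiv.prodComm (Site d) ℕ).tsum_eq (fun q : ℕ × Site d => |laceCoeff d 1 q.1 q.2| * z ^ q.1)
  -- `L ≤ Σ_M r^{M+1} ≤ 2r` through `[0,∞]`
  have hgeo : Summable fun M : ℕ => r ^ (M + 1) := by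
    simp_rw [pow_succ]
    exact (summable_geometric_of_lt_one hr0 (by linarith)).mul_right r
  have hLe : ENNReal.ofReal (∑' q : ℕ × Site d, |laceCoeff d 1 q.1 q.2| * z ^ q.1) ≤
      ENNReal.ofReal (∑' M : ℕ, r ^ (M + 1)) := by
    rw [ENNReal.ofReal_tsum_of_nonneg (fun q => by positivity) hπ,
      ENNReal.ofReal_tsum_of_nonneg (fun M => by positivity) hgeo]
    exact (tsum_ofReal_abs_laceCoeff_le hz0).trans (ENNReal.tsum_le_tsum fun M => tsum_piGen_le_ofReal h hz0 hzc M)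
  have hreal : ∑' q : ℕ × Site d, |laceCoeff d 1 q.1 q.2| * z ^ q.1 ≤ ∑' M : ℕ, r ^ (M + 1) :=
    (ENNReal.ofReal_le_ofReal_iff (tsum_nonneg fun M => by positivity)).1 hLe
  have hsum : ∑' M : ℕ, r ^ (M + 1) ≤ 2 * r := by
    simp_rw [pow_succ]
    rw [tsum_mul_right, tsum_geometric_of_lt_one hr0 (by linarith)]
    rw [inv_mul_le_iff₀ (by linarith)]
    nlinarith
  exact hL.trans (hreal.trans hsum)

/-! ### The high-dimensional package -/

/-- **The inputs from the converged lace expansion, in one eventual statement**: constants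
`c₀, C_b > 0` such that for all sufficiently large `d`: the uniform type bounds
`Σ_{a≤A} T_N(a) z^a ≤ (c₀/d)^N` on `[0, z_c]` with `c₀/d ≤ 1/4`; `2d z_c ≤ 1 + C_b/d`; and for every
`0 < z < z_c` the bootstrap inequalities `f₁, f₂, f₃ ≤ K` with `K ≤ 2`, absolute convergence of the
expansion, and `‖Π_z‖₁ ≤ 1`. [cite: Slade2006LaceExpansion, Theorem 5.1 and §5.4] -/
theorem exists_highDim_package :
    ∃ c₀ Cb : ℝ, 0 < c₀ ∧ 0 < Cb ∧ ∀ᶠ d : ℕ in atTop,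
      1 ≤ d ∧ c₀ / d ≤ 1 / 4 ∧
      (∀ (M A : ℕ) (z : ℝ), 0 ≤ z → z ≤ criticalPoint d →
        ∑ a ∈ Finset.range (A + 1), (diagTotal d a M : ℝ) * z ^ a ≤ (c₀ / d) ^ (M + 1)) ∧
      2 * (d : ℝ) * criticalPoint d ≤ 1 + Cb / d ∧
      (∀ z : ℝ, 0 < z → z < criticalPoint d → ∃ K : ℝ, K ≤ 2 ∧ Boot d K z ∧
        (Summable fun q : ℕ × Site d => |laceCoeff d 1 q.1 q.2| * z ^ q.1) ∧
        ∑' x, |lacePi d 1 z x| ≤ 1) := by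
  obtain ⟨c₀, hc₀, hgood⟩ := exists_sum_diagTotal_le
  obtain ⟨Cb', hCb'⟩ := two_mul_natCast_mul_criticalPoint_le
  obtain ⟨C, hC0, hboot⟩ := exists_boot_eventually
  refine ⟨c₀, max Cb' 1, hc₀, lt_of_lt_of_le zero_lt_one (le_max_right _ _), ?_⟩
  have hev : ∀ᶠ d : ℕ in atTop, c₀ / d ≤ 1 / 4 := by
    have : Tendsto (fun d : ℕ => c₀ / d) atTop (𝓝 0) := tendsto_const_nhds.div_atTop tendsto_natCast_atTop_atTop
    exact (this.eventually (Iic_mem_nhds (by norm_num : (0 : ℝ) < 1 / 4))).mono fun d hd => hd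
  filter_upwards [hgood, hCb', hboot (1 / C) (by positivity), hev, eventually_ge_atTop 1]
    with d h1 h2 h3 h4 h5
  have hd0 : (0 : ℝ) < d := by exact_mod_cast (show 0 < d by omega)
  refine ⟨h5, h4, h1, h2.trans (by gcongr; exact le_max_left _ _), fun z hz hzc => ?_⟩
  obtain ⟨β, hβ0, hβε, -, -, hb⟩ := h3
  have hCβ : C * β ≤ 1 := by
    calc C * β ≤ C * (1 / C) := by gcongr
      _ = 1 := by field_simp
  have hr2 : c₀ / d ≤ 1 / 2 := h4.trans (by norm_num)
  refine ⟨1 + C * β, by linarith, hb z ⟨hz.le, hzc⟩,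
    summable_abs_laceCoeff_of_ne_top hz.le (tsum_tsum_piGen_ne_top hc₀ hr2 h1 hz.le hzc.le), ?_⟩
  calc ∑' x, |lacePi d 1 z x| ≤ 2 * (c₀ / d) := tsum_abs_lacePi_le hc₀ hr2 h1 hz.le hzc.le
    _ ≤ 2 * (1 / 4) := by gcongr
    _ ≤ 1 := by norm_num

/-! ### Generic tools -/

/-- A bound valid on `(0, z_c)` for a continuous function persists at `z_c`. [folklore] -/
theorem le_criticalPoint_of_forall_lt [NeZero d] {f : ℝ → ℝ} (hf : Continuous f) {B : ℝ}
    (h : ∀ z : ℝ, 0 < z → z < criticalPoint d → f z ≤ B) : f (criticalPoint d) ≤ B := by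
  have hzc0 : 0 < criticalPoint d := criticalPoint_pos d
  have htend : Tendsto f (𝓝[<] criticalPoint d) (𝓝 (f (criticalPoint d))) :=
    (hf.tendsto _).mono_left nhdsWithin_le_nhds
  have hev : ∀ᶠ w in 𝓝[<] criticalPoint d, f w ≤ B := by
    have : Set.Ioo 0 (criticalPoint d) ∈ 𝓝[<] criticalPoint d := Ioo_mem_nhdsLT hzc0
    filter_upwards [this] with w hw
    exact h w hw.1 hw.2
  exact le_of_tendsto htend hev

/-- `c_k(x) ≤ c_k^{(0)}(x)` (self-avoiding walks are walks). [folklore] -/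
theorem countAt_le_srw_count (k : ℕ) (x : Site d) : countAt d k x ≤ SRW.count d k x := by
  classical
  rw [← card_sawSet]
  unfold SRW.count sawSet
  refine Finset.card_le_card fun σ hσ => ?_
  rw [Finset.mem_filter] at hσ ⊢
  exact ⟨Finset.mem_univ _, by rw [← pos_eq_endpoint]; exact hσ.2.2⟩

/-- `qSup ≤ qMax` (the maximum of self-avoiding counts is at most the maximum-principle bound on
simple-random-walk counts). [folklore] -/
theorem qSup_le_qMax [NeZero d] (k : ℕ) : qSup d k ≤ qMax d k := by
  obtain ⟨x, hx⟩ := exists_qSup_eq (d := d) k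
  rw [hx]
  exact (countAt_le_srw_count k x).trans (count_le_qMax k x)

/-- `z_c ≤ 1/d`, i.e. `2d z_c ≤ 2` (`μ ≥ d`). [cite: MadrasSlade1993, eq. (1.1.5)] -/
theorem two_mul_natCast_mul_criticalPoint_le_two (hd : 1 ≤ d) : 2 * (d : ℝ) * criticalPoint d ≤ 2 := by
  have hd0 : (0 : ℝ) < d := by exact_mod_cast (show 0 < d by omega)
  have hμ : (d : ℝ) ≤ connectiveConstant d := natCast_le_connectiveConstant d
  have hμ0 : 0 < connectiveConstant d := lt_of_lt_of_le hd0 hμ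
  unfold criticalPoint
  rw [show 2 * (d : ℝ) * (connectiveConstant d)⁻¹ = 2 * (d / connectiveConstant d) by ring]
  have : (d : ℝ) / connectiveConstant d ≤ 1 := by rw [div_le_one hμ0]; exact hμ
  linarith

/-! ### The pieces of the induction step at the critical point -/

/-- **Types `≥ M + 1` (the term `A₂`)**: in the good regime with `c₀/d ≤ 1/2`, for any finite set
of lengths, `Σ_{N' ∈ [M, L)} Σ_{a ∈ S} T(a, N') z^a ≤ 2 (c₀/d)^{M+1}`.
[cite: Graham2010, Section 6 (bound on `A₂` by (C_HS))] -/
theorem sum_types_ge_le {c₀ : ℝ} (hc₀ : 0 < c₀) (hr : c₀ / d ≤ 1 / 2)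
    (h : ∀ (M A : ℕ) (z : ℝ), 0 ≤ z → z ≤ criticalPoint d →
      ∑ a ∈ Finset.range (A + 1), (diagTotal d a M : ℝ) * z ^ a ≤ (c₀ / d) ^ (M + 1))
    {z : ℝ} (hz0 : 0 ≤ z) (hzc : z ≤ criticalPoint d) (M L A : ℕ) (S : Finset ℕ) (hS : S ⊆ Finset.range (A + 1)) :
    ∑ N' ∈ Finset.Ico M L, ∑ a ∈ S, (diagTotal d a N' : ℝ) * z ^ a ≤ 2 * (c₀ / d) ^ (M + 1) := by
  set r := c₀ / d with hr'
  have hr0 : 0 ≤ r := by rw [hr']; positivity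
  have hinner : ∀ N', ∑ a ∈ S, (diagTotal d a N' : ℝ) * z ^ a ≤ r ^ (N' + 1) := fun N' =>
    (Finset.sum_le_sum_of_subset_of_nonneg hS fun a _ _ => by positivity).trans (h N' A z hz0 hzc)
  calc ∑ N' ∈ Finset.Ico M L, ∑ a ∈ S, (diagTotal d a N' : ℝ) * z ^ a
      ≤ ∑ N' ∈ Finset.Ico M L, r ^ (N' + 1) := Finset.sum_le_sum fun N' _ => hinner N'
    _ = r ^ (M + 1) * ∑ j ∈ Finset.range (L - M), r ^ j := by
        rw [Finset.sum_Ico_eq_sum_range, Finset.mul_sum]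
        exact Finset.sum_congr rfl fun j _ => by ring
    _ ≤ r ^ (M + 1) * 2 := by
        refine mul_le_mul_of_nonneg_left ?_ (by positivity)
        have hgeo := summable_geometric_of_lt_one hr0 (by linarith : r < 1)
        calc ∑ j ∈ Finset.range (L - M), r ^ j ≤ ∑' j : ℕ, r ^ j :=
              hgeo.sum_le_tsum _ fun j _ => by positivity
          _ = (1 - r)⁻¹ := tsum_geometric_of_lt_one hr0 (by linarith)
          _ ≤ 2 := by rw [inv_le_comm₀ (by linarith) (by norm_num)]; linarith
    _ = 2 * (c₀ / d) ^ (M + 1) := by ring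

/-- **The weights of the short pieces** (`n < K₀`): `Σ_{n=1}^{K₀} (n+1) q'(n) z^n ≤ 576 Γ₀ s`,
`s = 1/(2d)`, when `(2dz)^k ≤ Γ₀` for `k ≤ K₀` and `144 (K₀+2) s ≤ 1`.
[cite: Graham2010, Lemma 7] -/
theorem sum_weight_short_le [NeZero d] {z Γ₀ : ℝ} (hz : 0 ≤ z) (hΓ₀ : 1 ≤ Γ₀) {K₀ : ℕ}
    (hθ : ∀ k, k ≤ K₀ → (2 * (d : ℝ) * z) ^ k ≤ Γ₀)
    (hratio : 144 * ((K₀ : ℝ) + 2) * (1 / (2 * (d : ℝ))) ≤ 1) :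
    ∑ n ∈ Finset.Icc 1 K₀, ((n : ℝ) + 1) * (qSup d n : ℝ) * z ^ n ≤ 576 * Γ₀ * (1 / (2 * (d : ℝ))) := by
  have hdpos : 0 < d := Nat.pos_of_neZero d
  have hd : (0 : ℝ) < d := by exact_mod_cast hdpos
  set s : ℝ := 1 / (2 * (d : ℝ)) with hs
  have hs0 : 0 < s := by rw [hs]; positivity
  have hKd : (K₀ + 1) / 2 ≤ d := by
    have h1 : 144 * ((K₀ : ℝ) + 2) ≤ 2 * d := by
      rw [hs] at hratio
      rwa [← mul_div_assoc, mul_one, div_le_one (by positivity)] at hratio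
    have h2 : (K₀ : ℝ) + 2 ≤ d := by nlinarith
    have h3 : K₀ + 2 ≤ d := by exact_mod_cast h2
    omega
  have hfb : ∀ k, 1 ≤ k → k ≤ K₀ →
      pieceWt d z K₀ k ≤ Γ₀ * (144 : ℝ) ^ ((k + 1) / 2) * (((k + 1) / 2).factorial : ℝ) * s ^ ((k + 1) / 2) :=
    fun k hk1 hkK => pieceWt_le hz hk1 hkK hKd (hθ k hkK)
  have hratio' : (144 : ℝ) * ((K₀ : ℝ) + 2) * s ≤ 1 := hratio
  have htail := sum_tail_le hs0 (zero_le_one.trans hΓ₀) (by norm_num : (0 : ℝ) ≤ 144) hfb hratio' 0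
  simp only [Nat.mul_zero, zero_add, pow_one, Nat.factorial_one, Nat.cast_one, mul_one] at htail
  -- compare termwise with `pieceWt`
  calc ∑ n ∈ Finset.Icc 1 K₀, ((n : ℝ) + 1) * (qSup d n : ℝ) * z ^ n
      ≤ ∑ n ∈ Finset.Icc 1 K₀, pieceWt d z K₀ n := by
        refine Finset.sum_le_sum fun n hn => ?_
        rw [Finset.mem_Icc] at hn
        unfold pieceWt
        rw [if_neg (by omega)]
        have : (qSup d n : ℝ) ≤ qMax d n := by exact_mod_cast qSup_le_qMax n
        gcongr
    _ = ∑ k ∈ Finset.range (K₀ + 1), (if 0 < k then pieceWt d z K₀ k else 0) := by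
        rw [Finset.sum_range_succ', if_neg (lt_irrefl 0), add_zero, ← Finset.Ico_add_one_right_eq_Icc,
          Finset.sum_Ico_eq_sum_range, show K₀ + 1 - 1 = K₀ from rfl]
        refine Finset.sum_congr rfl fun k _ => ?_
        rw [if_pos (Nat.succ_pos k), add_comm]
    _ ≤ 4 * Γ₀ * (144 * s) := htail
    _ = 576 * Γ₀ * s := by ring

/-- The long-piece tail constant `τ(p, K₀) = 8 p² (16^{p+1}+1) 6^{p+1} (2p/K₀)^{p-3}` (`K ≤ 2`,
`‖Π_z‖₁ ≤ 1`). [cite: Graham2010, Section 5] -/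
def tauLong (p K₀ : ℕ) : ℝ :=
  8 * (p : ℝ) ^ 2 * ((16 ^ (p + 1) + 1) * (6 : ℝ) ^ (p + 1)) * (2 * (p : ℝ) / K₀) ^ (p - 3)

/-- `0 ≤ τ`. [folklore] -/
theorem tauLong_nonneg (p K₀ : ℕ) : 0 ≤ tauLong p K₀ := by unfold tauLong; positivity

/-- **Lace graphs with a long piece, below the critical point**: for `0 < z < z_c` under the
bootstrap inequalities with `K ≤ 2` and `‖Π_z‖₁ ≤ 1`, with `p ≥ 4`, `K₀ ≥ 2p+2`, `d ≥ 6(p+1)+1`,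
`(2dz)^k ≤ Γ₀` (`k ≤ K₀`), `144(K₀+2)s ≤ 1` and `576 Γ₀ s + τ ≤ 1`:
`Σ_{a ≤ A} Gt(a, N, K₀) z^a ≤ 4 (N+1) τ`. [cite: Graham2010, Section 5 and Lemma 7] -/
theorem sum_diagTotalGt_le_of_lt [NeZero d] {p K₀ : ℕ} (hp : 4 ≤ p) (hd6 : 6 * (p + 1) + 1 ≤ d)
    (hK₀ : 2 * p + 2 ≤ K₀) {z : ℝ} (hz : 0 < z) (hzc : z < criticalPoint d)
    (h2dz : 2 * (d : ℝ) * z ≤ 2) {K : ℝ} (hK2 : K ≤ 2) (hboot : Boot d K z)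
    (hπ : Summable fun q : ℕ × Site d => |laceCoeff d 1 q.1 q.2| * z ^ q.1)
    (hPi : ∑' x, |lacePi d 1 z x| ≤ 1) {Γ₀ : ℝ} (hΓ₀ : 1 ≤ Γ₀)
    (hθ : ∀ k, k ≤ K₀ → (2 * (d : ℝ) * z) ^ k ≤ Γ₀)
    (hratio : 144 * ((K₀ : ℝ) + 2) * (1 / (2 * (d : ℝ))) ≤ 1)
    (hW : 576 * Γ₀ * (1 / (2 * (d : ℝ))) + tauLong p K₀ ≤ 1) (N A : ℕ) :
    ∑ a ∈ Finset.range (A + 1), (diagTotalGt d a N K₀ : ℝ) * z ^ a ≤ 4 * ((N : ℝ) + 1) * tauLong p K₀ := by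
  have hK0 : 0 ≤ K := le_trans (by positivity) hboot.f1
  have hP0 : 0 ≤ ∑' x, |lacePi d 1 z x| := tsum_nonneg fun x => abs_nonneg _
  have hmain := sum_diagTotalGt_mul_pow_le (Q' := qSup d) (fun k x => countAt_le_qSup k x) hz.le h2dz N K₀ A
  -- the tail
  have htail₀ := tail_weight_le hp hd6 hz hzc hboot hπ hK₀ A
  have hS : (16 ^ (p + 1) + 1) * (K * (K + ∑' x, |lacePi d 1 z x|)) ^ (p + 1) ≤
      (16 ^ (p + 1) + 1) * (6 : ℝ) ^ (p + 1) := by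
    have h6 : K * (K + ∑' x, |lacePi d 1 z x|) ≤ 6 := by nlinarith
    gcongr
  have htail : ∑ k ∈ Finset.Icc K₀ A, ((k : ℝ) + 1) * (qSup d k : ℝ) * z ^ k ≤ tauLong p K₀ := by
    refine htail₀.trans ?_
    unfold tauLong
    gcongr
  -- the full weight `W ≤ 576 Γ₀ s + τ ≤ 1`
  have hWle : ∑ n ∈ Finset.Icc 1 A, ((n : ℝ) + 1) * (qSup d n : ℝ) * z ^ n ≤ 1 := by
    have hsplit : ∑ n ∈ Finset.Icc 1 A, ((n : ℝ) + 1) * (qSup d n : ℝ) * z ^ n ≤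
        ∑ n ∈ Finset.Icc 1 K₀, ((n : ℝ) + 1) * (qSup d n : ℝ) * z ^ n +
          ∑ n ∈ Finset.Icc K₀ A, ((n : ℝ) + 1) * (qSup d n : ℝ) * z ^ n := by
      rw [← Finset.sum_union_inter]
      have hsub : Finset.Icc 1 A ⊆ Finset.Icc 1 K₀ ∪ Finset.Icc K₀ A := by
        intro n hn
        rw [Finset.mem_Icc] at hn
        rw [Finset.mem_union, Finset.mem_Icc, Finset.mem_Icc]
        omega
      have h1 := Finset.sum_le_sum_of_subset_of_nonneg hsub
        (f := fun n : ℕ => ((n : ℝ) + 1) * (qSup d n : ℝ) * z ^ n) fun n _ _ => by positivity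
      have h2 : 0 ≤ ∑ n ∈ Finset.Icc 1 K₀ ∩ Finset.Icc K₀ A, ((n : ℝ) + 1) * (qSup d n : ℝ) * z ^ n :=
        Finset.sum_nonneg fun n _ => by positivity
      linarith
    exact hsplit.trans ((add_le_add (sum_weight_short_le hz.le hΓ₀ hθ hratio) htail).trans hW)
  have hW0 : 0 ≤ ∑ n ∈ Finset.Icc 1 A, ((n : ℝ) + 1) * (qSup d n : ℝ) * z ^ n :=
    Finset.sum_nonneg fun n _ => by positivity
  calc ∑ a ∈ Finset.range (A + 1), (diagTotalGt d a N K₀ : ℝ) * z ^ a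
      ≤ 4 * ((N : ℝ) + 1) * (∑ k ∈ Finset.Icc K₀ A, ((k : ℝ) + 1) * (qSup d k : ℝ) * z ^ k) *
          (∑ n ∈ Finset.Icc 1 A, ((n : ℝ) + 1) * (qSup d n : ℝ) * z ^ n) ^ N := hmain
    _ ≤ 4 * ((N : ℝ) + 1) * tauLong p K₀ * 1 ^ N := by
        have hτ0 := tauLong_nonneg p K₀
        exact mul_le_mul (mul_le_mul_of_nonneg_left htail (by positivity)) (pow_le_pow_left₀ hW0 hWle N)
          (pow_nonneg hW0 N) (mul_nonneg (by positivity) hτ0)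
    _ = 4 * ((N : ℝ) + 1) * tauLong p K₀ := by rw [one_pow, mul_one]

/-- **Lace graphs with a long piece at the critical point**: the bound of
`sum_diagTotalGt_le_of_lt` persists at `z = z_c` (finite sums are polynomials in `z`).
[cite: Graham2010, Section 5] -/
theorem sum_diagTotalGt_criticalPoint_le [NeZero d] {p K₀ : ℕ} (hp : 4 ≤ p) (hd6 : 6 * (p + 1) + 1 ≤ d)
    (hK₀ : 2 * p + 2 ≤ K₀) (hd : 1 ≤ d) {Cb : ℝ} (hCb : 0 ≤ Cb)
    (hzcb : 2 * (d : ℝ) * criticalPoint d ≤ 1 + Cb / d)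
    (hbootz : ∀ z : ℝ, 0 < z → z < criticalPoint d → ∃ K : ℝ, K ≤ 2 ∧ Boot d K z ∧
      (Summable fun q : ℕ × Site d => |laceCoeff d 1 q.1 q.2| * z ^ q.1) ∧ ∑' x, |lacePi d 1 z x| ≤ 1)
    {Γ₀ : ℝ} (hΓ : (1 + Cb / d) ^ K₀ ≤ Γ₀)
    (hratio : 144 * ((K₀ : ℝ) + 2) * (1 / (2 * (d : ℝ))) ≤ 1)
    (hW : 576 * Γ₀ * (1 / (2 * (d : ℝ))) + tauLong p K₀ ≤ 1) (N A : ℕ) :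
    ∑ a ∈ Finset.range (A + 1), (diagTotalGt d a N K₀ : ℝ) * criticalPoint d ^ a ≤
      4 * ((N : ℝ) + 1) * tauLong p K₀ := by
  have hd0 : (0 : ℝ) < d := by exact_mod_cast (show 0 < d by omega)
  have hbase : 1 ≤ 1 + Cb / d := le_add_of_nonneg_right (by positivity)
  have hΓ₀ : 1 ≤ Γ₀ := le_trans (one_le_pow₀ hbase) hΓ
  have h2 := two_mul_natCast_mul_criticalPoint_le_two hd
  refine le_criticalPoint_of_forall_lt (f := fun z => ∑ a ∈ Finset.range (A + 1), (diagTotalGt d a N K₀ : ℝ) * z ^ a)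
    (continuous_finsetSum _ fun a _ => continuous_const.mul (continuous_pow a)) fun z hz hzc => ?_
  obtain ⟨K, hK2, hboot, hπ, hPi⟩ := hbootz z hz hzc
  have h2dz : 2 * (d : ℝ) * z ≤ 2 := by nlinarith
  have hθ : ∀ k, k ≤ K₀ → (2 * (d : ℝ) * z) ^ k ≤ Γ₀ := by
    intro k hk
    have hz1 : 2 * (d : ℝ) * z ≤ 1 + Cb / d := by nlinarith
    calc (2 * (d : ℝ) * z) ^ k ≤ (1 + Cb / d) ^ k := pow_le_pow_left₀ (by positivity) hz1 k
      _ ≤ (1 + Cb / d) ^ K₀ := pow_le_pow_right₀ hbase hk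
      _ ≤ Γ₀ := hΓ
  exact sum_diagTotalGt_le_of_lt hp hd6 hK₀ hz hzc h2dz hK2 hboot hπ hPi hΓ₀ hθ hratio hW N A

/-- Reindexing Graham's index set `I = {(a,b) : b + 1 ≤ a ≤ 2b}` below the length `2M`:
`Σ_{a<2M} Σ_{b<a} F(a,b) = Σ_{b=1}^{2M-2} Σ_{a=b+1}^{min(2b,2M-1)} F(a,b)` when `F` vanishes off `I`.
[cite: Graham2010, Section 3] -/
theorem sum_range_range_eq_sum_I (F : ℕ → ℕ → ℝ) (hF : ∀ a b, (a ≤ b ∨ 2 * b < a) → F a b = 0) (M : ℕ) :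
    ∑ a ∈ Finset.range (2 * M), ∑ b ∈ Finset.range a, F a b =
      ∑ b ∈ Finset.Icc 1 (2 * M - 2), ∑ a ∈ Finset.Icc (b + 1) (min (2 * b) (2 * M - 1)), F a b := by
  rw [Finset.sum_comm' (t' := Finset.range (2 * M)) (s' := fun b => Finset.Ioo b (2 * M))
    (fun a b => by simp only [Finset.mem_range, Finset.mem_Ioo]; omega)]
  symm
  refine Finset.sum_subset_zero_on_sdiff (fun b hb => ?_) (fun b hb => ?_) (fun b hb => ?_)
  · rw [Finset.mem_Icc] at hb; rw [Finset.mem_range]; omega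
  · rw [Finset.mem_sdiff, Finset.mem_range, Finset.mem_Icc] at hb
    refine Finset.sum_eq_zero fun a ha => ?_
    rw [Finset.mem_Ioo] at ha
    exact hF a b (by omega)
  · rw [Finset.mem_Icc] at hb
    refine Finset.sum_subset_zero_on_sdiff (fun a ha => ?_) (fun a ha => ?_) (fun a _ => rfl)
    · rw [Finset.mem_Icc] at ha; rw [Finset.mem_Ioo]; omega
    · rw [Finset.mem_sdiff, Finset.mem_Ioo, Finset.mem_Icc] at ha
      exact hF a b (by omega)

/-- `(M+1)^M ≤ e^{M+1} M!` (from `M^M/M! ≤ e^M` and `(1+1/M)^M ≤ e`), in the form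
`((M+1)/κ)^M ≤ e (e/κ)^M M!`. [folklore] -/
theorem succ_pow_le_exp_mul_factorial (M : ℕ) : ((M : ℝ) + 1) ^ M ≤ Real.exp 1 * Real.exp 1 ^ M * (M.factorial : ℝ) := by
  -- `(M+1)^M / M! ≤ Σ_k (M+1)^k/k! ≤ e^{M+1}`
  have h1 : ((M : ℝ) + 1) ^ M / (M.factorial : ℝ) ≤ Real.exp ((M : ℝ) + 1) :=
    Real.pow_div_factorial_le_exp ((M : ℝ) + 1) (by positivity) M
  have hfac : (0 : ℝ) < M.factorial := by exact_mod_cast Nat.factorial_pos M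
  rw [div_le_iff₀ hfac] at h1
  have hexp : Real.exp ((M : ℝ) + 1) = Real.exp 1 * Real.exp 1 ^ M := by
    rw [show ((M : ℝ) + 1) = ((M + 1 : ℕ) : ℝ) * 1 by push_cast; ring, Real.exp_nat_mul, pow_succ, mul_comm]
  calc ((M : ℝ) + 1) ^ M ≤ Real.exp ((M : ℝ) + 1) * (M.factorial : ℝ) := h1
    _ = Real.exp 1 * Real.exp 1 ^ M * (M.factorial : ℝ) := by rw [hexp]

/-- **The terms `A₂ + A₃` at the critical point**: in the high-dimensional regime, for `M ≥ 1`
with `1152 Γ₀ M s ≤ 1`,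
`|piHat d z_c - Σ_{a<2M} sgnTotal(a) z_c^a| ≤ (6912Γ₀)^{M+1}(M+1)! s^M + 4M(M+1)τ + 2(c₀/d)^{M+1}`
(lengths `a ≥ 2M`: types `≤ M` with all pieces `≤ K₀` by `sum_diagTotalLe_short_le`, types `≤ M`
with a long piece by `sum_diagTotalGt_criticalPoint_le`, types `≥ M+1` by the uniform type bounds).
[cite: Graham2010, Section 6 (the terms `A₂`, `A₃`)] -/
theorem abs_piHat_sub_sum_le [NeZero d] (hd : 1 ≤ d) {c₀ : ℝ} (hc₀ : 0 < c₀) (hr4 : c₀ / d ≤ 1 / 4)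
    (htype : ∀ (M A : ℕ) (z : ℝ), 0 ≤ z → z ≤ criticalPoint d →
      ∑ a ∈ Finset.range (A + 1), (diagTotal d a M : ℝ) * z ^ a ≤ (c₀ / d) ^ (M + 1))
    {Cb : ℝ} (hCb : 0 ≤ Cb) (hzcb : 2 * (d : ℝ) * criticalPoint d ≤ 1 + Cb / d)
    (hbootz : ∀ z : ℝ, 0 < z → z < criticalPoint d → ∃ K : ℝ, K ≤ 2 ∧ Boot d K z ∧
      (Summable fun q : ℕ × Site d => |laceCoeff d 1 q.1 q.2| * z ^ q.1) ∧ ∑' x, |lacePi d 1 z x| ≤ 1)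
    {p K₀ : ℕ} (hp : 4 ≤ p) (hd6 : 6 * (p + 1) + 1 ≤ d) (hK₀ : 2 * p + 2 ≤ K₀)
    {Γ₀ : ℝ} (hΓ : (1 + Cb / d) ^ K₀ ≤ Γ₀)
    (hratio : 144 * ((K₀ : ℝ) + 2) * (1 / (2 * (d : ℝ))) ≤ 1)
    (hW : 576 * Γ₀ * (1 / (2 * (d : ℝ))) + tauLong p K₀ ≤ 1)
    {M : ℕ} (hM : 1 ≤ M) (hsmall : 1152 * Γ₀ * M * (1 / (2 * (d : ℝ))) ≤ 1) :
    |piHat d (criticalPoint d) - ∑ a ∈ Finset.range (2 * M), sgnTotal d a * criticalPoint d ^ a| ≤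
      (6912 * Γ₀) ^ (M + 1) * ((M + 1).factorial : ℝ) * (1 / (2 * (d : ℝ))) ^ M +
        4 * M * (M + 1) * tauLong p K₀ + 2 * (c₀ / d) ^ (M + 1) := by
  have hd0 : (0 : ℝ) < d := by exact_mod_cast (show 0 < d by omega)
  set β := criticalPoint d with hβ
  have hβ0 : 0 < β := criticalPoint_pos d
  have hr2 : c₀ / d ≤ 1 / 2 := hr4.trans (by norm_num)
  have hbase : 1 ≤ 1 + Cb / d := le_add_of_nonneg_right (by positivity)
  have hΓ₀ : 1 ≤ Γ₀ := le_trans (one_le_pow₀ hbase) hΓ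
  have hτ0 := tauLong_nonneg p K₀
  set τ := tauLong p K₀ with hτ
  set s : ℝ := 1 / (2 * (d : ℝ)) with hs
  -- `(2dβ)^k ≤ Γ₀`
  have hθ : ∀ k, k ≤ K₀ → (2 * (d : ℝ) * β) ^ k ≤ Γ₀ := by
    intro k hk
    calc (2 * (d : ℝ) * β) ^ k ≤ (1 + Cb / d) ^ k := pow_le_pow_left₀ (by positivity) hzcb k
      _ ≤ (1 + Cb / d) ^ K₀ := pow_le_pow_right₀ hbase hk
      _ ≤ Γ₀ := hΓ
  -- the bound on every partial sum of the tail
  set Bnd : ℝ := (6912 * Γ₀) ^ (M + 1) * ((M + 1).factorial : ℝ) * s ^ M + 4 * M * (M + 1) * τ +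
      2 * (c₀ / d) ^ (M + 1) with hBnd
  have hpartial : ∀ A : ℕ, 2 * M ≤ A + 1 →
      |∑ a ∈ Finset.Ico (2 * M) (A + 1), sgnTotal d a * β ^ a| ≤ Bnd := by
    intro A hA
    -- split the types at `M`
    have hsplit : ∀ a ∈ Finset.Ico (2 * M) (A + 1), sgnTotal d a * β ^ a =
        (∑ N' ∈ Finset.range M, (-1 : ℝ) ^ N' * (diagTotal d a N' : ℝ)) * β ^ a +
          (∑ N' ∈ Finset.Ico M a, (-1 : ℝ) ^ N' * (diagTotal d a N' : ℝ)) * β ^ a := by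
      intro a ha
      rw [Finset.mem_Ico] at ha
      rw [sgnTotal, ← add_mul, Finset.sum_range_add_sum_Ico _ (by omega)]
    rw [Finset.sum_congr rfl hsplit, Finset.sum_add_distrib]
    -- low types: `Le + Gt`
    have hlow : |∑ a ∈ Finset.Ico (2 * M) (A + 1),
        (∑ N' ∈ Finset.range M, (-1 : ℝ) ^ N' * (diagTotal d a N' : ℝ)) * β ^ a| ≤
        (6912 * Γ₀) ^ (M + 1) * ((M + 1).factorial : ℝ) * s ^ M + 4 * M * (M + 1) * τ := by
      calc |∑ a ∈ Finset.Ico (2 * M) (A + 1), (∑ N' ∈ Finset.range M, (-1 : ℝ) ^ N' * (diagTotal d a N' : ℝ)) * β ^ a|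
          ≤ ∑ a ∈ Finset.Ico (2 * M) (A + 1), ∑ N' ∈ Finset.range M, (diagTotal d a N' : ℝ) * β ^ a := by
            refine (Finset.abs_sum_le_sum_abs _ _).trans (Finset.sum_le_sum fun a _ => ?_)
            rw [abs_mul, abs_pow, abs_of_pos hβ0, ← Finset.sum_mul]
            refine mul_le_mul_of_nonneg_right ((Finset.abs_sum_le_sum_abs _ _).trans (le_of_eq ?_)) (by positivity)
            refine Finset.sum_congr rfl fun N' _ => ?_
            rw [abs_mul, abs_pow, abs_neg, abs_one, one_pow, one_mul, Nat.abs_cast]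
        _ = ∑ N' ∈ Finset.range M, ∑ a ∈ Finset.Ico (2 * M) (A + 1),
              ((diagTotalLe d a N' K₀ : ℝ) * β ^ a + (diagTotalGt d a N' K₀ : ℝ) * β ^ a) := by
            rw [Finset.sum_comm]
            refine Finset.sum_congr rfl fun N' _ => Finset.sum_congr rfl fun a _ => ?_
            rw [diagTotal_eq_add d a N' K₀]; push_cast; ring
        _ = ∑ N ∈ Finset.Icc 1 M, ∑ a ∈ Finset.Icc (2 * M) A, (diagTotalLe d a (N - 1) K₀ : ℝ) * β ^ a +
              ∑ N' ∈ Finset.range M, ∑ a ∈ Finset.Ico (2 * M) (A + 1), (diagTotalGt d a N' K₀ : ℝ) * β ^ a := by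
            rw [Finset.sum_congr rfl fun N' _ => Finset.sum_add_distrib, Finset.sum_add_distrib]
            congr 1
            rw [Finset.Ico_add_one_right_eq_Icc]
            refine Finset.sum_nbij' (fun N' => N' + 1) (fun N => N - 1) ?_ ?_ ?_ ?_ ?_
            · intro N' hN'; rw [Finset.mem_range] at hN'; rw [Finset.mem_Icc]; omega
            · intro N hN; rw [Finset.mem_Icc] at hN; rw [Finset.mem_range]; omega
            · intro N' _; simp
            · intro N hN; rw [Finset.mem_Icc] at hN; omega
            · intro N' _; simp
        _ ≤ (6912 * Γ₀) ^ (M + 1) * ((M + 1).factorial : ℝ) * s ^ M +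
              ∑ N' ∈ Finset.range M, (4 * ((N' : ℝ) + 1) * τ) := by
            refine add_le_add (sum_diagTotalLe_short_le hβ0.le hΓ₀ hM hθ hsmall hratio A)
              (Finset.sum_le_sum fun N' _ => ?_)
            refine le_trans (Finset.sum_le_sum_of_subset_of_nonneg (fun a ha => ?_) fun a _ _ => by positivity)
              (sum_diagTotalGt_criticalPoint_le hp hd6 hK₀ hd hCb hzcb hbootz hΓ hratio hW N' A)
            rw [Finset.mem_Ico] at ha; rw [Finset.mem_range]; exact ha.2
        _ ≤ (6912 * Γ₀) ^ (M + 1) * ((M + 1).factorial : ℝ) * s ^ M + 4 * M * (M + 1) * τ := by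
            refine add_le_add le_rfl ?_
            calc ∑ N' ∈ Finset.range M, (4 * ((N' : ℝ) + 1) * τ) ≤ ∑ _N' ∈ Finset.range M, (4 * ((M : ℝ) + 1) * τ) := by
                  refine Finset.sum_le_sum fun N' hN' => ?_
                  rw [Finset.mem_range] at hN'
                  have : (N' : ℝ) + 1 ≤ M + 1 := by
                    have : (N' : ℝ) ≤ M := by exact_mod_cast hN'.le
                    linarith
                  gcongr
              _ = 4 * M * (M + 1) * τ := by rw [Finset.sum_const, Finset.card_range, nsmul_eq_mul]; ring
    -- high types
    have hhigh : |∑ a ∈ Finset.Ico (2 * M) (A + 1),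
        (∑ N' ∈ Finset.Ico M a, (-1 : ℝ) ^ N' * (diagTotal d a N' : ℝ)) * β ^ a| ≤ 2 * (c₀ / d) ^ (M + 1) := by
      calc |∑ a ∈ Finset.Ico (2 * M) (A + 1), (∑ N' ∈ Finset.Ico M a, (-1 : ℝ) ^ N' * (diagTotal d a N' : ℝ)) * β ^ a|
          ≤ ∑ a ∈ Finset.Ico (2 * M) (A + 1), ∑ N' ∈ Finset.Ico M a, (diagTotal d a N' : ℝ) * β ^ a := by
            refine (Finset.abs_sum_le_sum_abs _ _).trans (Finset.sum_le_sum fun a _ => ?_)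
            rw [abs_mul, abs_pow, abs_of_pos hβ0, ← Finset.sum_mul]
            refine mul_le_mul_of_nonneg_right ((Finset.abs_sum_le_sum_abs _ _).trans (le_of_eq ?_)) (by positivity)
            refine Finset.sum_congr rfl fun N' _ => ?_
            rw [abs_mul, abs_pow, abs_neg, abs_one, one_pow, one_mul, Nat.abs_cast]
        _ ≤ ∑ a ∈ Finset.Ico (2 * M) (A + 1), ∑ N' ∈ Finset.Ico M (A + 1), (diagTotal d a N' : ℝ) * β ^ a := by
            refine Finset.sum_le_sum fun a ha => ?_
            rw [Finset.mem_Ico] at ha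
            exact Finset.sum_le_sum_of_subset_of_nonneg (Finset.Ico_subset_Ico_right (by omega)) fun N' _ _ => by positivity
        _ = ∑ N' ∈ Finset.Ico M (A + 1), ∑ a ∈ Finset.Ico (2 * M) (A + 1), (diagTotal d a N' : ℝ) * β ^ a :=
            Finset.sum_comm
        _ ≤ 2 * (c₀ / d) ^ (M + 1) :=
            sum_types_ge_le hc₀ hr2 htype hβ0.le le_rfl M (A + 1) A (Finset.Ico (2 * M) (A + 1))
              (fun a ha => by rw [Finset.mem_Ico] at ha; rw [Finset.mem_range]; exact ha.2)
    calc _ ≤ |∑ a ∈ Finset.Ico (2 * M) (A + 1), (∑ N' ∈ Finset.range M, (-1 : ℝ) ^ N' * (diagTotal d a N' : ℝ)) * β ^ a| +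
          |∑ a ∈ Finset.Ico (2 * M) (A + 1), (∑ N' ∈ Finset.Ico M a, (-1 : ℝ) ^ N' * (diagTotal d a N' : ℝ)) * β ^ a| :=
          abs_add_le _ _
      _ ≤ _ := by rw [hBnd]; linarith
  -- pass to the limit `A → ∞`
  obtain ⟨hsumabs, -⟩ := summable_absTotal hc₀ hr2 htype hβ0.le le_rfl
  have hsum : Summable fun a => sgnTotal d a * β ^ a := by
    refine hsumabs.of_norm_bounded fun a => ?_
    rw [Real.norm_eq_abs, abs_mul, abs_pow, abs_of_pos hβ0]
    exact mul_le_mul_of_nonneg_right (abs_sgnTotal_le d a) (by positivity)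
  have htend : Tendsto (fun n : ℕ => ∑ a ∈ Finset.range n, sgnTotal d a * β ^ a) atTop (𝓝 (piHat d β)) := by
    unfold piHat
    exact hsum.hasSum.tendsto_sum_nat
  have htend' : Tendsto (fun A : ℕ => ∑ a ∈ Finset.range (A + 1), sgnTotal d a * β ^ a -
      ∑ a ∈ Finset.range (2 * M), sgnTotal d a * β ^ a) atTop
      (𝓝 (piHat d β - ∑ a ∈ Finset.range (2 * M), sgnTotal d a * β ^ a)) :=
    ((htend.comp (tendsto_add_atTop_nat 1)).sub tendsto_const_nhds)
  have hev : ∀ᶠ A : ℕ in atTop, |∑ a ∈ Finset.range (A + 1), sgnTotal d a * β ^ a -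
      ∑ a ∈ Finset.range (2 * M), sgnTotal d a * β ^ a| ≤ Bnd := by
    filter_upwards [eventually_ge_atTop (2 * M)] with A hA
    rw [← Finset.sum_Ico_eq_sub _ (by omega : 2 * M ≤ A + 1)]
    exact hpartial A (by omega)
  exact le_of_tendsto htend'.abs hev

/-! ### Elementary estimates for the term `A₄` -/

/-- `(k+1)! ≤ (k+1)^k`. [folklore] -/
theorem factorial_succ_le_pow_self (k : ℕ) : (((k + 1).factorial : ℕ) : ℝ) ≤ ((k : ℝ) + 1) ^ k := by
  have h : (k + 1).factorial ≤ (k + 1) ^ k := by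
    induction k with
    | zero => simp
    | succ k ih =>
      rw [Nat.factorial_succ, pow_succ]
      calc (k + 1 + 1) * (k + 1).factorial ≤ (k + 1 + 1) * (k + 1) ^ k := Nat.mul_le_mul_left _ ih
        _ ≤ (k + 1 + 1) * (k + 1 + 1) ^ k := Nat.mul_le_mul_left _ (Nat.pow_le_pow_left (by omega) k)
        _ = (k + 1 + 1) ^ k * (k + 1 + 1) := mul_comm _ _
  have : (((k + 1).factorial : ℕ) : ℝ) ≤ (((k + 1) ^ k : ℕ) : ℝ) := by exact_mod_cast h
  simpa using this

/-- `b² ≤ 4^{b-1}` for `b ≥ 1`. [folklore] -/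
theorem sq_le_four_pow {b : ℕ} (hb : 1 ≤ b) : (b : ℝ) ^ 2 ≤ 4 ^ (b - 1) := by
  obtain ⟨n, rfl⟩ : ∃ n, b = n + 1 := ⟨b - 1, by omega⟩
  simp only [Nat.add_sub_cancel]
  clear hb
  have key : ∀ n : ℕ, ((n : ℝ) + 1) ^ 2 ≤ 4 ^ n := by
    intro n
    induction n with
    | zero => norm_num
    | succ n ih =>
      push_cast
      calc ((n : ℝ) + 1 + 1) ^ 2 ≤ 4 * ((n : ℝ) + 1) ^ 2 := by
            have hn : (0 : ℝ) ≤ n := Nat.cast_nonneg n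
            nlinarith
        _ ≤ 4 * 4 ^ n := by gcongr
        _ = 4 ^ (n + 1) := by ring
  have := key n
  push_cast
  exact this

/-- **`V̂(t) ≤ 3/2`**: `Σ_{k ≤ M-2} |v_k| t^k ≤ 3/2` when `|αₙ| ≤ C₂ⁿ n!` (`C₂ ≥ 1`), `(M+1) t ≤ κ`
and `4 C₂² κ ≤ 1` (the constant term is `u₀ = 1`; for `k ≥ 1`, `|u_k| t^k ≤ C₂^{k+1}(k+1)! t^k ≤ C₂ (C₂κ)^k`).
[cite: Graham2010, Lemma 3] -/
theorem vHat_le {c : ℕ → ℕ → ℝ} {C₂ κ t : ℝ} (hC₂ : 1 ≤ C₂) (hα : ∀ n, |alpha c n| ≤ C₂ ^ n * (n.factorial : ℝ))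
    (ht : 0 ≤ t) {M : ℕ} (hMt : ((M : ℝ) + 1) * t ≤ κ) (hκ : 4 * C₂ ^ 2 * κ ≤ 1) :
    ∑ k ∈ Finset.range (M - 2 + 1), |vTrunc c M k| * t ^ k ≤ 3 / 2 := by
  have hκ0 : 0 ≤ κ := le_trans (by positivity) hMt
  have hC₂κ : C₂ * κ ≤ 1 / 2 := by nlinarith
  -- the `k = 0` term and the rest
  rw [Finset.sum_range_succ']
  have h0 : |vTrunc c M 0| * t ^ 0 ≤ 1 := by
    rw [pow_zero, mul_one]
    unfold vTrunc
    split_ifs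
    · rw [coefU_zero, abs_one]
    · rw [abs_zero]; exact zero_le_one
  have hrest : ∑ k ∈ Finset.range (M - 2), |vTrunc c M (k + 1)| * t ^ (k + 1) ≤ 1 / 2 := by
    have hterm : ∀ k ∈ Finset.range (M - 2), |vTrunc c M (k + 1)| * t ^ (k + 1) ≤ C₂ ^ 2 * κ * (1 / 2 : ℝ) ^ k := by
      intro k hk
      rw [Finset.mem_range] at hk
      have hv : |vTrunc c M (k + 1)| ≤ C₂ ^ (k + 2) * ((k + 2).factorial : ℝ) := by
        unfold vTrunc
        split_ifs
        · have := hα (k + 2)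
          rwa [show alpha c (k + 2) = coefU c (k + 1) from rfl] at this
        · rw [abs_zero]; positivity
      have hfac : (((k + 2).factorial : ℕ) : ℝ) ≤ ((k : ℝ) + 2) ^ (k + 1) := by
        have := factorial_succ_le_pow_self (k + 1)
        push_cast at this ⊢
        rw [show (k : ℝ) + 1 + 1 = k + 2 by ring] at this
        exact this
      have hkt : ((k : ℝ) + 2) * t ≤ κ := by
        have : (k : ℝ) + 2 ≤ M + 1 := by
          have : (k : ℝ) + 2 < M := by exact_mod_cast (show k + 2 < M by omega)
          linarith
        nlinarith
      calc |vTrunc c M (k + 1)| * t ^ (k + 1) ≤ C₂ ^ (k + 2) * ((k : ℝ) + 2) ^ (k + 1) * t ^ (k + 1) := by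
            have : 0 ≤ t ^ (k + 1) := pow_nonneg ht _
            have h' : |vTrunc c M (k + 1)| ≤ C₂ ^ (k + 2) * ((k : ℝ) + 2) ^ (k + 1) :=
              hv.trans (mul_le_mul_of_nonneg_left hfac (by positivity))
            exact mul_le_mul_of_nonneg_right h' this
        _ = C₂ ^ (k + 2) * (((k : ℝ) + 2) * t) ^ (k + 1) := by rw [mul_assoc, ← mul_pow]
        _ ≤ C₂ ^ (k + 2) * κ ^ (k + 1) := by gcongr
        _ = C₂ ^ 2 * κ * (C₂ * κ) ^ k := by ring
        _ ≤ C₂ ^ 2 * κ * (1 / 2 : ℝ) ^ k := by gcongr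
    calc ∑ k ∈ Finset.range (M - 2), |vTrunc c M (k + 1)| * t ^ (k + 1)
        ≤ ∑ k ∈ Finset.range (M - 2), C₂ ^ 2 * κ * (1 / 2 : ℝ) ^ k := Finset.sum_le_sum hterm
      _ = C₂ ^ 2 * κ * ∑ k ∈ Finset.range (M - 2), (1 / 2 : ℝ) ^ k := by rw [Finset.mul_sum]
      _ ≤ C₂ ^ 2 * κ * 2 :=
          mul_le_mul_of_nonneg_left (sum_geometric_two_le _) (by positivity)
      _ ≤ 1 / 2 := by nlinarith
  linarith

/-- Lemma 4 on a truncated `a`-range. [cite: Graham2010, Lemma 4] -/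
theorem sum_abs_grahamC_trunc_le {b : ℕ} (hb : 1 ≤ b) (L : ℕ) :
    ∑ a ∈ Finset.Icc (b + 1) (min (2 * b) L), |grahamC a b| ≤ (1296 : ℝ) ^ b * (b.factorial : ℝ) :=
  (Finset.sum_le_sum_of_subset_of_nonneg (Finset.Icc_subset_Icc_right (min_le_left _ _))
    fun _ _ _ => abs_nonneg _).trans (grahamC_lemma4 b hb)

/-- `s · V(s) = Σ_{n=1}^{M-1} αₙ sⁿ` (`V` has the coefficients `u_i = α_{i+1}`, `i ≤ M - 2`). [folklore] -/
theorem mul_vPoly_eq (c : ℕ → ℕ → ℝ) {M : ℕ} (hM : 1 ≤ M) (t : ℝ) :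
    t * vPoly c M t = ∑ n ∈ Finset.Ico 1 M, alpha c n * t ^ n := by
  unfold vPoly vTrunc
  rcases Nat.lt_or_ge M 2 with hM1 | hM2
  · have : M = 1 := by omega
    subst this
    simp
  · rw [Finset.sum_Ico_eq_sum_range, show M - 1 = M - 2 + 1 by omega, Finset.mul_sum]
    refine Finset.sum_congr rfl fun k hk => ?_
    rw [Finset.mem_range] at hk
    rw [if_pos (by omega), show alpha c (1 + k) = coefU c k by rw [add_comm]; rfl, add_comm 1 k, pow_succ]
    ring

/-- The `b`-sum in the bound on `HIGH₀`: `Σ_{b=1}^{2M-2} 1296^b b! ρ^b (9/4)^b ≤ 1` when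
`(M+1)ρ ≤ κ` and `11664 κ ≤ 1`. [folklore] -/
theorem sum_b_high_le {ρ κ : ℝ} (hρ : 0 ≤ ρ) {M : ℕ} (hMρ : ((M : ℝ) + 1) * ρ ≤ κ) (hκ : 11664 * κ ≤ 1) :
    ∑ b ∈ Finset.Icc 1 (2 * M - 2), (1296 : ℝ) ^ b * (b.factorial : ℝ) * ρ ^ b * (9 / 4 : ℝ) ^ b ≤ 1 := by
  have hκ0 : 0 ≤ κ := le_trans (by positivity) hMρ
  have hterm : ∀ b ∈ Finset.Icc 1 (2 * M - 2),
      (1296 : ℝ) ^ b * (b.factorial : ℝ) * ρ ^ b * (9 / 4 : ℝ) ^ b ≤ (1 / 2 : ℝ) ^ b := by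
    intro b hb
    rw [Finset.mem_Icc] at hb
    have hfac : (b.factorial : ℝ) ≤ (b : ℝ) ^ b := by exact_mod_cast Nat.factorial_le_pow b
    have hbρ : (b : ℝ) * ρ ≤ 2 * κ := by
      have : (b : ℝ) ≤ 2 * (M + 1) := by
        have : (b : ℝ) ≤ 2 * M - 2 := by
          have h := hb.2
          have : ((2 * M - 2 : ℕ) : ℝ) = 2 * M - 2 := by
            rw [Nat.cast_sub (by omega)]; push_cast; ring
          rw [← this]; exact_mod_cast h
        linarith
      nlinarith
    calc (1296 : ℝ) ^ b * (b.factorial : ℝ) * ρ ^ b * (9 / 4 : ℝ) ^ b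
        ≤ (1296 : ℝ) ^ b * (b : ℝ) ^ b * ρ ^ b * (9 / 4 : ℝ) ^ b := by gcongr
      _ = (1296 * (9 / 4) * ((b : ℝ) * ρ)) ^ b := by rw [mul_pow, mul_pow, mul_pow]; ring
      _ ≤ (1296 * (9 / 4) * (2 * κ)) ^ b := by gcongr
      _ ≤ (1 / 2 : ℝ) ^ b := pow_le_pow_left₀ (by positivity) (by nlinarith) b
  calc ∑ b ∈ Finset.Icc 1 (2 * M - 2), (1296 : ℝ) ^ b * (b.factorial : ℝ) * ρ ^ b * (9 / 4 : ℝ) ^ b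
      ≤ ∑ b ∈ Finset.Icc 1 (2 * M - 2), (1 / 2 : ℝ) ^ b := Finset.sum_le_sum hterm
    _ ≤ 1 := by
        rw [← Finset.Ico_add_one_right_eq_Icc, Finset.sum_Ico_eq_sum_range]
        calc ∑ k ∈ Finset.range (2 * M - 2 + 1 - 1), (1 / 2 : ℝ) ^ (1 + k)
            = (1 / 2 : ℝ) * ∑ k ∈ Finset.range (2 * M - 2 + 1 - 1), (1 / 2 : ℝ) ^ k := by
              rw [Finset.mul_sum]; exact Finset.sum_congr rfl fun k _ => by rw [pow_add, pow_one]
          _ ≤ (1 / 2 : ℝ) * 2 := mul_le_mul_of_nonneg_left (sum_geometric_two_le _) (by norm_num)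
          _ = 1 := by norm_num

/-- The `b`-sum in the bound on `W`: `Σ_{b=1}^{2M-2} b 4^b s^b 1296^b b! ≤ 10368 s` when
`(M+1)s ≤ C₅` and `82944 C₅ ≤ 1`. [folklore] -/
theorem sum_b_W_le {s C₅ : ℝ} (hs : 0 ≤ s) {M : ℕ} (hMs : ((M : ℝ) + 1) * s ≤ C₅) (hC₅ : 82944 * C₅ ≤ 1) :
    ∑ b ∈ Finset.Icc 1 (2 * M - 2), ((b : ℝ) * 4 ^ b * s ^ b) * ((1296 : ℝ) ^ b * (b.factorial : ℝ)) ≤ 10368 * s := by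
  have hC₅0 : 0 ≤ C₅ := le_trans (by positivity) hMs
  have hterm : ∀ b ∈ Finset.Icc 1 (2 * M - 2),
      ((b : ℝ) * 4 ^ b * s ^ b) * ((1296 : ℝ) ^ b * (b.factorial : ℝ)) ≤ 5184 * s * (1 / 2 : ℝ) ^ (b - 1) := by
    intro b hb
    rw [Finset.mem_Icc] at hb
    obtain ⟨n, rfl⟩ : ∃ n, b = n + 1 := ⟨b - 1, by omega⟩
    simp only [Nat.add_sub_cancel]
    -- `(n+1)! s^n ≤ (n+1) (n s)^n ≤ (n+1) (2C₅)^n`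
    have hfac : (n.factorial : ℝ) ≤ (n : ℝ) ^ n := by exact_mod_cast Nat.factorial_le_pow n
    have hns : (n : ℝ) * s ≤ 2 * C₅ := by
      have : (n : ℝ) ≤ 2 * (M + 1) := by
        have h := hb.2
        have : ((2 * M - 2 : ℕ) : ℝ) = 2 * M - 2 := by rw [Nat.cast_sub (by omega)]; push_cast; ring
        have : ((n + 1 : ℕ) : ℝ) ≤ 2 * M - 2 := by rw [← this]; exact_mod_cast h
        push_cast at this
        linarith
      nlinarith
    have hsq := sq_le_four_pow (b := n + 1) (by omega)
    simp only [Nat.add_sub_cancel] at hsq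
    push_cast [Nat.factorial_succ] at hsq ⊢
    calc ((n : ℝ) + 1) * 4 ^ (n + 1) * s ^ (n + 1) * ((1296 : ℝ) ^ (n + 1) * (((n : ℝ) + 1) * (n.factorial : ℝ)))
        = 5184 * s * (((n : ℝ) + 1) ^ 2 * ((4 : ℝ) ^ n * 1296 ^ n) * ((n.factorial : ℝ) * s ^ n)) := by ring
      _ ≤ 5184 * s * (((n : ℝ) + 1) ^ 2 * ((4 : ℝ) ^ n * 1296 ^ n) * ((n : ℝ) ^ n * s ^ n)) := by gcongr
      _ = 5184 * s * (((n : ℝ) + 1) ^ 2 * (4 * 1296 * ((n : ℝ) * s)) ^ n) := by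
          rw [mul_pow, mul_pow, mul_pow]; ring
      _ ≤ 5184 * s * ((4 : ℝ) ^ n * (4 * 1296 * (2 * C₅)) ^ n) := by gcongr
      _ = 5184 * s * (4 * (4 * 1296 * (2 * C₅))) ^ n := by rw [← mul_pow]
      _ ≤ 5184 * s * (1 / 2 : ℝ) ^ n := by
          gcongr
          nlinarith
  calc ∑ b ∈ Finset.Icc 1 (2 * M - 2), ((b : ℝ) * 4 ^ b * s ^ b) * ((1296 : ℝ) ^ b * (b.factorial : ℝ))
      ≤ ∑ b ∈ Finset.Icc 1 (2 * M - 2), 5184 * s * (1 / 2 : ℝ) ^ (b - 1) := Finset.sum_le_sum hterm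
    _ = 5184 * s * ∑ b ∈ Finset.Icc 1 (2 * M - 2), (1 / 2 : ℝ) ^ (b - 1) := by rw [Finset.mul_sum]
    _ ≤ 5184 * s * 2 := by
        refine mul_le_mul_of_nonneg_left ?_ (by positivity)
        rw [← Finset.Ico_add_one_right_eq_Icc, Finset.sum_Ico_eq_sum_range]
        simp only [Nat.add_sub_cancel_left]
        exact sum_geometric_two_le _
    _ = 10368 * s := by ring

/-! ### The induction step -/

/-- Budget (i): `(6912Γ₀)^{M+1} ≤ ⅛ C₆^{M+1}` when `8·6912 Γ₀ ≤ C₆`. [folklore] -/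
theorem budget_short {Γ₀ C₆ F S : ℝ} (hΓ₀ : 0 ≤ Γ₀) (hC₆ : 8 * 6912 * Γ₀ ≤ C₆) (hF : 0 ≤ F) (hS : 0 ≤ S) (M : ℕ) :
    (6912 * Γ₀) ^ (M + 1) * F * S ≤ 1 / 8 * (C₆ ^ (M + 1) * F * S) := by
  have h1 : (6912 * Γ₀) ^ (M + 1) ≤ (C₆ / 8) ^ (M + 1) := pow_le_pow_left₀ (by positivity) (by linarith) (M + 1)
  have h2 : (C₆ / 8) ^ (M + 1) ≤ 1 / 8 * C₆ ^ (M + 1) := by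
    have hC₆ : 0 ≤ C₆ := le_trans (by positivity) hC₆
    rw [div_pow, pow_succ (8 : ℝ) M, div_le_iff₀ (by positivity)]
    have : (1 : ℝ) ≤ 8 ^ M := one_le_pow₀ (by norm_num)
    have hC : 0 ≤ C₆ ^ (M + 1) := by positivity
    nlinarith
  calc (6912 * Γ₀) ^ (M + 1) * F * S ≤ (1 / 8 * C₆ ^ (M + 1)) * F * S := by gcongr; exact h1.trans h2
    _ = _ := by ring

/-- Budget (iii): `2 (2c₀ s)^{M+1} ≤ ⅛ C₆^{M+1} F s^M` when `2c₀ ≤ C₆`, `s ≤ 1/16`, `F ≥ 1`. [folklore] -/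
theorem budget_types {c₀ C₆ s F : ℝ} (hc₀ : 0 ≤ c₀) (hC₆ : 2 * c₀ ≤ C₆) (hs : 0 ≤ s) (hs16 : s ≤ 1 / 16)
    (hF : 1 ≤ F) (M : ℕ) :
    2 * (2 * c₀ * s) ^ (M + 1) ≤ 1 / 8 * (C₆ ^ (M + 1) * F * s ^ M) := by
  have h1 : (2 * c₀) ^ (M + 1) ≤ C₆ ^ (M + 1) := pow_le_pow_left₀ (by positivity) hC₆ (M + 1)
  have hC : 0 ≤ C₆ ^ (M + 1) := le_trans (by positivity) h1
  rw [mul_pow, pow_succ]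
  calc 2 * ((2 * c₀) ^ (M + 1) * (s ^ M * s)) ≤ 2 * (C₆ ^ (M + 1) * (s ^ M * s)) := by gcongr
    _ = (2 * s) * (C₆ ^ (M + 1) * 1 * s ^ M) := by ring
    _ ≤ (1 / 8) * (C₆ ^ (M + 1) * F * s ^ M) := by
        refine mul_le_mul (by linarith) ?_ (by positivity) (by norm_num)
        gcongr

/-- Budget (iv): `e (e/κ)^M M! s^M ≤ ⅛ C₆^{M+1} (M+1)! s^M` when `e/κ ≤ C₆` and `8e ≤ C₆`. [folklore] -/
theorem budget_high {κ C₆ s : ℝ} (hκ : 0 < κ) (hC₆d : Real.exp 1 / κ ≤ C₆) (hC₆c : 8 * Real.exp 1 ≤ C₆)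
    (hs : 0 ≤ s) (M : ℕ) :
    Real.exp 1 * (Real.exp 1 / κ) ^ M * (M.factorial : ℝ) * s ^ M ≤
      1 / 8 * (C₆ ^ (M + 1) * ((M + 1).factorial : ℝ) * s ^ M) := by
  have h2 : (Real.exp 1 / κ) ^ M ≤ C₆ ^ M := pow_le_pow_left₀ (by positivity) hC₆d M
  have h3 : Real.exp 1 ≤ 1 / 8 * C₆ := by linarith
  have hC₆0 : 0 ≤ C₆ := le_trans (by positivity) hC₆c
  have hfac : (M.factorial : ℝ) ≤ ((M + 1).factorial : ℝ) := by exact_mod_cast Nat.factorial_le (Nat.le_succ M)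
  calc Real.exp 1 * (Real.exp 1 / κ) ^ M * (M.factorial : ℝ) * s ^ M
      ≤ (1 / 8 * C₆) * C₆ ^ M * ((M + 1).factorial : ℝ) * s ^ M := by gcongr
    _ = 1 / 8 * (C₆ ^ (M + 1) * ((M + 1).factorial : ℝ) * s ^ M) := by rw [pow_succ]; ring

/-- Budget (v): `10368 C₆^M M! s^M ≤ ⅛ C₆^{M+1} (M+1)! s^M` when `82944 ≤ C₆`. [folklore] -/
theorem budget_W {C₆ s : ℝ} (hC₆e : 82944 ≤ C₆) (hs : 0 ≤ s) (M : ℕ) :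
    10368 * (C₆ ^ M * (M.factorial : ℝ) * s ^ M) ≤ 1 / 8 * (C₆ ^ (M + 1) * ((M + 1).factorial : ℝ) * s ^ M) := by
  have hC₆ : 0 ≤ C₆ := le_trans (by norm_num) hC₆e
  rw [pow_succ, Nat.factorial_succ]
  push_cast
  have hM0 : (1 : ℝ) ≤ (M : ℝ) + 1 := by linarith [(Nat.cast_nonneg M : (0 : ℝ) ≤ M)]
  have hC : 0 ≤ C₆ ^ M * (M.factorial : ℝ) * s ^ M := by positivity
  calc 10368 * (C₆ ^ M * (M.factorial : ℝ) * s ^ M) = (10368 * 1) * (C₆ ^ M * (M.factorial : ℝ) * s ^ M) := by ring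
    _ ≤ (1 / 8 * C₆ * ((M : ℝ) + 1)) * (C₆ ^ M * (M.factorial : ℝ) * s ^ M) := by
        refine mul_le_mul_of_nonneg_right ?_ hC
        nlinarith
    _ = 1 / 8 * (C₆ ^ M * C₆ * (((M : ℝ) + 1) * (M.factorial : ℝ)) * s ^ M) := by ring

/-- `(s(M+1)/κ)^M ≤ e (e/κ)^M M! s^M`. [folklore] -/
theorem ratio_pow_le {s κ : ℝ} (hs : 0 ≤ s) (hκ : 0 < κ) (M : ℕ) :
    (s / (κ / ((M : ℝ) + 1))) ^ M ≤ Real.exp 1 * (Real.exp 1 / κ) ^ M * (M.factorial : ℝ) * s ^ M := by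
  have hM1 : (0 : ℝ) < (M : ℝ) + 1 := by positivity
  have e1 : s / (κ / ((M : ℝ) + 1)) = ((M : ℝ) + 1) * s / κ := by field_simp
  rw [e1, div_pow, mul_pow]
  calc ((M : ℝ) + 1) ^ M * s ^ M / κ ^ M
      ≤ Real.exp 1 * Real.exp 1 ^ M * (M.factorial : ℝ) * s ^ M / κ ^ M := by
        gcongr
        exact succ_pow_le_exp_mul_factorial M
    _ = Real.exp 1 * (Real.exp 1 / κ) ^ M * (M.factorial : ℝ) * s ^ M := by rw [div_pow]; ring

set_option maxHeartbeats 800000 in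
/-- **The induction step of Graham §6 at infinite memory.** In the high-dimensional regime at
dimension `d` (inputs as in `exists_highDim_package`, the short/long piece parameters `p, K₀, Γ₀`
with `576Γ₀ s + τ ≤ 1`, and the long-piece budget `4M(M+1)τ ≤ ⅛ C₆^{M+1}(M+1)! s^M`), with
`s = 1/(2d)`, `|αₙ| ≤ C₂ⁿ n!` and admissible constants `C₅ ≪ 1 ≪ C₆`:
if `(M+1) s ≤ C₅` and `|z_c - Σ_{n<M} αₙ sⁿ| ≤ C₆^M M! s^M` then
`|z_c - Σ_{n ≤ M} αₙ sⁿ| ≤ C₆^{M+1} (M+1)! s^{M+1}`. [cite: Graham2010, Section 6, eq. (C8)] -/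
theorem graham_step [NeZero d] (hd : 1 ≤ d) {c₀ : ℝ} (hc₀ : 0 < c₀) (hr4 : c₀ / d ≤ 1 / 4)
    (htype : ∀ (M A : ℕ) (z : ℝ), 0 ≤ z → z ≤ criticalPoint d →
      ∑ a ∈ Finset.range (A + 1), (diagTotal d a M : ℝ) * z ^ a ≤ (c₀ / d) ^ (M + 1))
    {Cb : ℝ} (hCb : 0 ≤ Cb) (hzcb : 2 * (d : ℝ) * criticalPoint d ≤ 1 + Cb / d)
    (hbootz : ∀ z : ℝ, 0 < z → z < criticalPoint d → ∃ K : ℝ, K ≤ 2 ∧ Boot d K z ∧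
      (Summable fun q : ℕ × Site d => |laceCoeff d 1 q.1 q.2| * z ^ q.1) ∧ ∑' x, |lacePi d 1 z x| ≤ 1)
    {p K₀ : ℕ} (hp : 4 ≤ p) (hd6 : 6 * (p + 1) + 1 ≤ d) (hK₀ : 2 * p + 2 ≤ K₀)
    {Γ₀ : ℝ} (hΓ : (1 + Cb / d) ^ K₀ ≤ Γ₀)
    (hratio : 144 * ((K₀ : ℝ) + 2) * (1 / (2 * (d : ℝ))) ≤ 1)
    (hW : 576 * Γ₀ * (1 / (2 * (d : ℝ))) + tauLong p K₀ ≤ 1)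
    {C₂ : ℝ} (hC₂ : 1 ≤ C₂) (hα : ∀ n, |alpha grahamC n| ≤ C₂ ^ n * (n.factorial : ℝ))
    {C₅ C₆ : ℝ} (hC₅κ : 46656 * C₂ ^ 2 * C₅ ≤ 1) (hC₅Γ : 1152 * Γ₀ * C₅ ≤ 1) (hC₅c : 82944 * C₅ ≤ 1)
    (hC₆a : 8 * 6912 * Γ₀ ≤ C₆) (hC₆b : 2 * c₀ ≤ C₆) (hC₆c : 8 * Real.exp 1 ≤ C₆)
    (hC₆d : Real.exp 1 * (46656 * C₂ ^ 2) ≤ C₆) (hC₆e : 82944 ≤ C₆)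
    (hd16 : 1 / (2 * (d : ℝ)) ≤ 1 / 16)
    {M : ℕ} (hM : 1 ≤ M) (hsM : ((M : ℝ) + 1) * (1 / (2 * (d : ℝ))) ≤ C₅)
    (hτM : 4 * (M : ℝ) * (M + 1) * tauLong p K₀ ≤
      1 / 8 * (C₆ ^ (M + 1) * ((M + 1).factorial : ℝ) * (1 / (2 * (d : ℝ))) ^ M))
    (IH : |criticalPoint d - ∑ n ∈ Finset.Ico 1 M, alpha grahamC n * (1 / (2 * (d : ℝ))) ^ n| ≤
      C₆ ^ M * (M.factorial : ℝ) * (1 / (2 * (d : ℝ))) ^ M) :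
    |criticalPoint d - ∑ n ∈ Finset.Ico 1 (M + 1), alpha grahamC n * (1 / (2 * (d : ℝ))) ^ n| ≤
      C₆ ^ (M + 1) * ((M + 1).factorial : ℝ) * (1 / (2 * (d : ℝ))) ^ (M + 1) := by
  have hd0 : (0 : ℝ) < d := by exact_mod_cast (show 0 < d by omega)
  set s : ℝ := 1 / (2 * (d : ℝ)) with hs
  have hs0 : 0 < s := by rw [hs]; positivity
  have hs2d : s * (2 * d) = 1 := by rw [hs]; field_simp
  set β := criticalPoint d with hβ
  have hβ0 : 0 < β := criticalPoint_pos d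
  obtain ⟨U, hU⟩ : ∃ U : ℝ, U = 2 * (d : ℝ) * β := ⟨_, rfl⟩
  have hU0 : 0 ≤ U := by rw [hU]; positivity
  have hU2 : U ≤ 2 := by rw [hU]; exact two_mul_natCast_mul_criticalPoint_le_two hd
  have hUabs : |U| ≤ 2 := by rw [abs_of_nonneg hU0]; exact hU2
  have hβsU : β = s * U := by rw [hU, ← mul_assoc, hs2d, one_mul]
  have hr2 : c₀ / d ≤ 1 / 2 := hr4.trans (by norm_num)
  have hC₅0 : 0 ≤ C₅ := le_trans (by positivity) hsM
  have hMs : (M : ℝ) * s ≤ C₅ := by nlinarith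
  have hΓ00 : 0 ≤ Γ₀ := le_trans (by positivity) (le_trans (one_le_pow₀ (le_add_of_nonneg_right (by positivity))) hΓ)
  -- constants
  have he : (0 : ℝ) < Real.exp 1 := Real.exp_pos 1
  obtain ⟨κ, hκ⟩ : ∃ κ : ℝ, κ = 1 / (46656 * C₂ ^ 2) := ⟨_, rfl⟩
  have hκ0 : 0 < κ := by rw [hκ]; positivity
  have hC₂sq : (1 : ℝ) ≤ C₂ ^ 2 := one_le_pow₀ hC₂
  have hC₂ne : C₂ ≠ 0 := by positivity
  have hC₅κ' : C₅ ≤ κ := by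
    rw [hκ, le_div_iff₀ (by positivity)]
    calc C₅ * (46656 * C₂ ^ 2) = 46656 * C₂ ^ 2 * C₅ := by ring
      _ ≤ 1 := hC₅κ
  have h4κ : 4 * C₂ ^ 2 * κ ≤ 1 := by
    rw [hκ, show 4 * C₂ ^ 2 * (1 / (46656 * C₂ ^ 2)) = 4 / 46656 by field_simp]
    norm_num
  have h11κ : 11664 * κ ≤ 1 := by
    rw [hκ, ← div_eq_mul_one_div, div_le_one (by positivity)]
    linarith
  have heκ : Real.exp 1 / κ ≤ C₆ := by rw [hκ, div_div_eq_mul_div, div_one]; exact hC₆d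
  -- Step 1: factor out `s`
  have hstep1 : β - ∑ n ∈ Finset.Ico 1 (M + 1), alpha grahamC n * s ^ n =
      s * (U - ∑ i ∈ Finset.range M, coefU grahamC i * s ^ i) := by
    rw [hβsU, mul_sub, Finset.sum_Ico_eq_sum_range, show M + 1 - 1 = M from rfl, Finset.mul_sum]
    congr 1
    refine Finset.sum_congr rfl fun i _ => ?_
    rw [show alpha grahamC (1 + i) = coefU grahamC i by rw [add_comm]; rfl, pow_add, pow_one]
    ring
  suffices hX : |U - ∑ i ∈ Finset.range M, coefU grahamC i * s ^ i| ≤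
      C₆ ^ (M + 1) * ((M + 1).factorial : ℝ) * s ^ M by
    rw [hstep1, abs_mul, abs_of_pos hs0, show s ^ (M + 1) = s * s ^ M from pow_succ' s M]
    calc s * |U - ∑ i ∈ Finset.range M, coefU grahamC i * s ^ i|
        ≤ s * (C₆ ^ (M + 1) * ((M + 1).factorial : ℝ) * s ^ M) := mul_le_mul_of_nonneg_left hX hs0.le
      _ = _ := by ring
  -- Step 2: `U = 1 + piHat`; `R = Σ_{a<2M} sgnTotal(a) β^a`
  have hUid : U = 1 + piHat d β := by rw [hU]; exact two_mul_natCast_mul_criticalPoint_eq hc₀ hr2 hd htype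
  obtain ⟨R, hR⟩ : ∃ R : ℝ, R = ∑ a ∈ Finset.range (2 * M), sgnTotal d a * β ^ a := ⟨_, rfl⟩
  -- Step 3: `|piHat - R| ≤ …`
  have hsmall : 1152 * Γ₀ * M * (1 / (2 * (d : ℝ))) ≤ 1 := by
    calc 1152 * Γ₀ * M * (1 / (2 * (d : ℝ))) = 1152 * Γ₀ * (M * s) := by rw [hs]; ring
      _ ≤ 1152 * Γ₀ * C₅ := by gcongr
      _ ≤ 1 := hC₅Γ
  have h23 := abs_piHat_sub_sum_le hd hc₀ hr4 htype hCb hzcb hbootz hp hd6 hK₀ hΓ hratio hW hM hsmall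
  rw [← hR] at h23
  -- Step 4: `R = Σ_{b,a} c_{a,b} s^b U^a` and the decomposition of `X`
  have hRI : R = ∑ b ∈ Finset.Icc 1 (2 * M - 2), ∑ a ∈ Finset.Icc (b + 1) (min (2 * b) (2 * M - 1)),
      grahamC a b * s ^ b * U ^ a := by
    rw [hR, ← sum_range_range_eq_sum_I (fun a b => grahamC a b * s ^ b * U ^ a)
      (fun a b hab => by rw [grahamC_eq_zero hab, zero_mul, zero_mul]) M]
    refine Finset.sum_congr rfl fun a _ => ?_
    rw [sgnTotal_mul_pow_eq hd β a, Finset.sum_mul, hU]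
  obtain ⟨V, hV⟩ : ∃ V : ℝ, V = vPoly grahamC M s := ⟨_, rfl⟩
  have hdecomp : U - ∑ i ∈ Finset.range M, coefU grahamC i * s ^ i =
      (piHat d β - R) + ((pPoly grahamC M s - ∑ i ∈ Finset.range M, coefU grahamC i * s ^ i) +
        ∑ b ∈ Finset.Icc 1 (2 * M - 2), ∑ a ∈ Finset.Icc (b + 1) (min (2 * b) (2 * M - 1)),
          grahamC a b * s ^ b * (U ^ a - V ^ a)) := by
    have hP : pPoly grahamC M s = 1 + ∑ b ∈ Finset.Icc 1 (2 * M - 2), ∑ a ∈ Finset.Icc (b + 1) (min (2 * b) (2 * M - 1)),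
        grahamC a b * s ^ b * V ^ a := by rw [hV]; rfl
    have hsplit : ∑ b ∈ Finset.Icc 1 (2 * M - 2), ∑ a ∈ Finset.Icc (b + 1) (min (2 * b) (2 * M - 1)),
          grahamC a b * s ^ b * (U ^ a - V ^ a) =
        R - ∑ b ∈ Finset.Icc 1 (2 * M - 2), ∑ a ∈ Finset.Icc (b + 1) (min (2 * b) (2 * M - 1)),
          grahamC a b * s ^ b * V ^ a := by
      rw [hRI, ← Finset.sum_sub_distrib]
      refine Finset.sum_congr rfl fun b _ => ?_
      rw [← Finset.sum_sub_distrib]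
      refine Finset.sum_congr rfl fun a _ => ?_
      ring
    rw [hsplit, hP, hUid]
    ring
  -- (H) the bound on `HIGH₀`
  have hM1 : (0 : ℝ) < (M : ℝ) + 1 := by positivity
  obtain ⟨ρ, hρ⟩ : ∃ ρ : ℝ, ρ = κ / ((M : ℝ) + 1) := ⟨_, rfl⟩
  have hρ0 : 0 < ρ := by rw [hρ]; positivity
  have hMρ : ((M : ℝ) + 1) * ρ ≤ κ := by rw [hρ, mul_div_cancel₀ _ hM1.ne']
  have hsρ : s ≤ ρ := by
    rw [hρ, le_div_iff₀ hM1]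
    calc s * ((M : ℝ) + 1) = ((M : ℝ) + 1) * s := mul_comm _ _
      _ ≤ C₅ := hsM
      _ ≤ κ := hC₅κ'
  have hVhatρ : ∑ k ∈ Finset.range (M - 2 + 1), |vTrunc grahamC M k| * ρ ^ k ≤ 3 / 2 :=
    vHat_le hC₂ hα hρ0.le hMρ h4κ
  have hVhats : ∑ k ∈ Finset.range (M - 2 + 1), |vTrunc grahamC M k| * s ^ k ≤ 3 / 2 :=
    vHat_le hC₂ hα hs0.le (hsM.trans hC₅κ') h4κ
  have hHIGH : |pPoly grahamC M s - ∑ i ∈ Finset.range M, coefU grahamC i * s ^ i| ≤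
      Real.exp 1 * (Real.exp 1 / κ) ^ M * (M.factorial : ℝ) * s ^ M := by
    refine (abs_highZero_le grahamC hM hs0.le hsρ).trans ?_
    have hsum : ∑ b ∈ Finset.Icc 1 (2 * M - 2), ∑ a ∈ Finset.Icc (b + 1) (min (2 * b) (2 * M - 1)),
        |grahamC a b| * ρ ^ b * (∑ k ∈ Finset.range (M - 2 + 1), |vTrunc grahamC M k| * ρ ^ k) ^ a ≤ 1 := by
      have h0 : 0 ≤ ∑ k ∈ Finset.range (M - 2 + 1), |vTrunc grahamC M k| * ρ ^ k :=
        Finset.sum_nonneg fun k _ => by positivity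
      calc _ ≤ ∑ b ∈ Finset.Icc 1 (2 * M - 2), (1296 : ℝ) ^ b * (b.factorial : ℝ) * ρ ^ b * (9 / 4 : ℝ) ^ b := by
            refine Finset.sum_le_sum fun b hb => ?_
            rw [Finset.mem_Icc] at hb
            have hVa : ∀ a ∈ Finset.Icc (b + 1) (min (2 * b) (2 * M - 1)),
                |grahamC a b| * ρ ^ b * (∑ k ∈ Finset.range (M - 2 + 1), |vTrunc grahamC M k| * ρ ^ k) ^ a ≤
                |grahamC a b| * (ρ ^ b * (9 / 4 : ℝ) ^ b) := by
              intro a ha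
              rw [Finset.mem_Icc] at ha
              have h1 : (∑ k ∈ Finset.range (M - 2 + 1), |vTrunc grahamC M k| * ρ ^ k) ^ a ≤ (3 / 2 : ℝ) ^ (2 * b) :=
                (pow_le_pow_left₀ h0 hVhatρ a).trans (pow_le_pow_right₀ (by norm_num) (le_trans ha.2 (min_le_left _ _)))
              have h3 : (3 / 2 : ℝ) ^ (2 * b) = (9 / 4 : ℝ) ^ b := by rw [pow_mul]; norm_num
              rw [mul_assoc]
              refine mul_le_mul_of_nonneg_left ?_ (abs_nonneg _)
              rw [← h3]
              exact mul_le_mul_of_nonneg_left h1 (by positivity)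
            calc _ ≤ ∑ a ∈ Finset.Icc (b + 1) (min (2 * b) (2 * M - 1)), |grahamC a b| * (ρ ^ b * (9 / 4 : ℝ) ^ b) :=
                  Finset.sum_le_sum hVa
              _ = (∑ a ∈ Finset.Icc (b + 1) (min (2 * b) (2 * M - 1)), |grahamC a b|) * (ρ ^ b * (9 / 4 : ℝ) ^ b) := by
                  rw [Finset.sum_mul]
              _ ≤ ((1296 : ℝ) ^ b * (b.factorial : ℝ)) * (ρ ^ b * (9 / 4 : ℝ) ^ b) :=
                  mul_le_mul_of_nonneg_right (sum_abs_grahamC_trunc_le hb.1 _) (by positivity)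
              _ = _ := by ring
        _ ≤ 1 := sum_b_high_le hρ0.le hMρ h11κ
    have hsr0 : 0 ≤ (s / ρ) ^ M := by positivity
    calc (s / ρ) ^ M * _ ≤ (s / ρ) ^ M * 1 := mul_le_mul_of_nonneg_left hsum hsr0
      _ ≤ _ := by rw [mul_one, hρ]; exact ratio_pow_le hs0.le hκ0 M
  -- (W) the term with `E_M`
  have hVabs : |V| ≤ 2 := by
    have : |V| ≤ ∑ k ∈ Finset.range (M - 2 + 1), |vTrunc grahamC M k| * s ^ k := by
      rw [hV]; unfold vPoly
      refine (Finset.abs_sum_le_sum_abs _ _).trans (le_of_eq (Finset.sum_congr rfl fun k _ => ?_))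
      rw [abs_mul, abs_pow, abs_of_pos hs0]
    linarith
  have hsUV : s * |U - V| ≤ C₆ ^ M * (M.factorial : ℝ) * s ^ M := by
    have e1 : s * (U - V) = β - ∑ n ∈ Finset.Ico 1 M, alpha grahamC n * s ^ n := by
      rw [mul_sub, ← hβsU, hV, mul_vPoly_eq grahamC hM s]
    have e2 : s * |U - V| = |s * (U - V)| := by rw [abs_mul, abs_of_pos hs0]
    rw [e2, e1]
    exact IH
  have hWb : |∑ b ∈ Finset.Icc 1 (2 * M - 2), ∑ a ∈ Finset.Icc (b + 1) (min (2 * b) (2 * M - 1)),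
      grahamC a b * s ^ b * (U ^ a - V ^ a)| ≤ 10368 * (C₆ ^ M * (M.factorial : ℝ) * s ^ M) := by
    refine (abs_W_le grahamC M hs0.le hUabs hVabs).trans ?_
    have hbsum : ∑ b ∈ Finset.Icc 1 (2 * M - 2), ((b : ℝ) * 4 ^ b * s ^ b) *
        ∑ a ∈ Finset.Icc (b + 1) (min (2 * b) (2 * M - 1)), |grahamC a b| ≤ 10368 * s := by
      calc _ ≤ ∑ b ∈ Finset.Icc 1 (2 * M - 2), ((b : ℝ) * 4 ^ b * s ^ b) * ((1296 : ℝ) ^ b * (b.factorial : ℝ)) := by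
            refine Finset.sum_le_sum fun b hb => ?_
            rw [Finset.mem_Icc] at hb
            exact mul_le_mul_of_nonneg_left (sum_abs_grahamC_trunc_le hb.1 _) (by positivity)
        _ ≤ 10368 * s := sum_b_W_le hs0.le hsM hC₅c
    calc |U - V| * _ ≤ |U - V| * (10368 * s) := mul_le_mul_of_nonneg_left hbsum (abs_nonneg _)
      _ = 10368 * (s * |U - V|) := by ring
      _ ≤ 10368 * (C₆ ^ M * (M.factorial : ℝ) * s ^ M) := by gcongr
  -- the budget
  have hfac1' : (1 : ℝ) ≤ ((M + 1).factorial : ℝ) := by exact_mod_cast Nat.succ_le_of_lt (Nat.factorial_pos (M + 1))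
  have hb1 := budget_short hΓ00 hC₆a (le_trans zero_le_one hfac1') (pow_nonneg hs0.le M) M
  have hb3 : 2 * (c₀ / d) ^ (M + 1) ≤ 1 / 8 * (C₆ ^ (M + 1) * ((M + 1).factorial : ℝ) * s ^ M) := by
    have e1 : c₀ / d = 2 * c₀ * s := by rw [hs]; field_simp
    rw [e1]
    exact budget_types hc₀.le hC₆b hs0.le hd16 hfac1' M
  have hb4 := budget_high hκ0 heκ hC₆c hs0.le M
  have hb5 := budget_W hC₆e hs0.le M
  -- assemble
  rw [hdecomp]
  calc |piHat d β - R + (pPoly grahamC M s - ∑ i ∈ Finset.range M, coefU grahamC i * s ^ i +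
        ∑ b ∈ Finset.Icc 1 (2 * M - 2), ∑ a ∈ Finset.Icc (b + 1) (min (2 * b) (2 * M - 1)),
          grahamC a b * s ^ b * (U ^ a - V ^ a))|
      ≤ |piHat d β - R| + (|pPoly grahamC M s - ∑ i ∈ Finset.range M, coefU grahamC i * s ^ i| +
        |∑ b ∈ Finset.Icc 1 (2 * M - 2), ∑ a ∈ Finset.Icc (b + 1) (min (2 * b) (2 * M - 1)),
          grahamC a b * s ^ b * (U ^ a - V ^ a)|) :=
        (abs_add_le _ _).trans (add_le_add le_rfl (abs_add_le _ _))
    _ ≤ (1 / 8 * (C₆ ^ (M + 1) * ((M + 1).factorial : ℝ) * s ^ M) +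
          1 / 8 * (C₆ ^ (M + 1) * ((M + 1).factorial : ℝ) * s ^ M) +
          1 / 8 * (C₆ ^ (M + 1) * ((M + 1).factorial : ℝ) * s ^ M)) +
        (1 / 8 * (C₆ ^ (M + 1) * ((M + 1).factorial : ℝ) * s ^ M) +
          1 / 8 * (C₆ ^ (M + 1) * ((M + 1).factorial : ℝ) * s ^ M)) := by
        refine add_le_add (h23.trans ?_) (add_le_add (hHIGH.trans hb4) (hWb.trans hb5))
        exact add_le_add (add_le_add hb1 hτM) hb3
    _ ≤ C₆ ^ (M + 1) * ((M + 1).factorial : ℝ) * s ^ M := by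
        have : 0 ≤ C₆ ^ (M + 1) * ((M + 1).factorial : ℝ) * s ^ M := by
          have hC₆0 : 0 ≤ C₆ := le_trans (by norm_num) hC₆e
          positivity
        linarith

/-! ### The long-piece budget: `τ` is exponentially small in `d` -/

/-- `(q+3)² ≤ 9 · 2^q`. [folklore] -/
theorem sq_add_three_le (q : ℕ) : ((q : ℝ) + 3) ^ 2 ≤ 9 * 2 ^ q := by
  induction q with
  | zero => norm_num
  | succ q ih =>
    push_cast
    have hq : (0 : ℝ) ≤ q := Nat.cast_nonneg q
    calc ((q : ℝ) + 1 + 3) ^ 2 ≤ 2 * ((q : ℝ) + 3) ^ 2 := by nlinarith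
      _ ≤ 2 * (9 * 2 ^ q) := by gcongr
      _ = 9 * 2 ^ (q + 1) := by ring

/-- **The tail constant with `K₀ = 512 p`**: `τ(p, 512p) ≤ 144 · 96⁴ · (3/4)^{p-3}` for `p ≥ 3`.
[folklore] -/
theorem tauLong_le {p : ℕ} (hp : 3 ≤ p) : tauLong p (512 * p) ≤ 144 * (96 : ℝ) ^ 4 * (3 / 4 : ℝ) ^ (p - 3) := by
  obtain ⟨q, rfl⟩ : ∃ q, p = q + 3 := ⟨p - 3, by omega⟩
  simp only [Nat.add_sub_cancel]
  unfold tauLong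
  have hp0 : (0 : ℝ) < ((q + 3 : ℕ) : ℝ) := by positivity
  have hratio : 2 * ((q + 3 : ℕ) : ℝ) / ((512 * (q + 3) : ℕ) : ℝ) = 1 / 256 := by
    push_cast
    field_simp
    ring
  rw [hratio]
  have h16 : (16 : ℝ) ^ (q + 3 + 1) + 1 ≤ 2 * 16 ^ (q + 3 + 1) := by
    have : (1 : ℝ) ≤ 16 ^ (q + 3 + 1) := one_le_pow₀ (by norm_num)
    linarith
  have hsq := sq_add_three_le q
  calc 8 * ((q + 3 : ℕ) : ℝ) ^ 2 * ((16 ^ (q + 3 + 1) + 1) * (6 : ℝ) ^ (q + 3 + 1)) * (1 / 256 : ℝ) ^ q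
      ≤ 8 * (9 * 2 ^ q) * ((2 * 16 ^ (q + 3 + 1)) * (6 : ℝ) ^ (q + 3 + 1)) * (1 / 256 : ℝ) ^ q := by
        push_cast
        gcongr
    _ = 144 * (96 : ℝ) ^ 4 * (((1 / 256 : ℝ) * 2 * 6 * 16) ^ q) := by
        rw [mul_pow, mul_pow, mul_pow]
        ring
    _ = 144 * (96 : ℝ) ^ 4 * (3 / 4 : ℝ) ^ q := by norm_num

/-- `(3/4)^{⌊d/q⌋} ≤ (4/3) exp(-(log(4/3)/q) d)`. [folklore] -/
theorem three_quarters_pow_div_le (d : ℕ) {q : ℕ} (hq : 0 < q) :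
    (3 / 4 : ℝ) ^ (d / q) ≤ 4 / 3 * Real.exp (-(Real.log (4 / 3) / q) * d) := by
  have hq0 : (0 : ℝ) < q := by exact_mod_cast hq
  have hlog : 0 < Real.log (4 / 3) := Real.log_pos (by norm_num)
  -- `⌊d/q⌋ ≥ d/q - 1`
  have hfloor : (d : ℝ) / q - 1 ≤ ((d / q : ℕ) : ℝ) := by
    have h := Nat.lt_div_mul_add hq (a := d)  -- d < d / q * q + q
    have h' : (d : ℝ) < ((d / q : ℕ) : ℝ) * q + q := by exact_mod_cast h
    rw [div_sub_one hq0.ne', div_le_iff₀ hq0]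
    linarith
  have e34 : (3 / 4 : ℝ) = Real.exp (-Real.log (4 / 3)) := by
    rw [Real.exp_neg, Real.exp_log (by norm_num)]; norm_num
  have hpow : (3 / 4 : ℝ) ^ (d / q) = Real.exp (-(Real.log (4 / 3)) * ((d / q : ℕ) : ℝ)) := by
    rw [e34, ← Real.exp_nat_mul, mul_comm]
  rw [hpow]
  have hexp : -(Real.log (4 / 3)) * ((d / q : ℕ) : ℝ) ≤ Real.log (4 / 3) + -(Real.log (4 / 3) / q) * d := by
    have : -(Real.log (4 / 3)) * ((d / q : ℕ) : ℝ) ≤ -(Real.log (4 / 3)) * ((d : ℝ) / q - 1) := by nlinarith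
    refine this.trans (le_of_eq ?_)
    field_simp
    ring
  calc Real.exp (-(Real.log (4 / 3)) * ((d / q : ℕ) : ℝ)) ≤ Real.exp (Real.log (4 / 3) + -(Real.log (4 / 3) / q) * d) :=
        Real.exp_le_exp.2 hexp
    _ = 4 / 3 * Real.exp (-(Real.log (4 / 3) / q) * d) := by rw [Real.exp_add, Real.exp_log (by norm_num)]

/-- `C (2 + log(1/(C₆ C))) ≤ 4 √C` for `0 < C ≤ 1 ≤ C₆`. [folklore] -/
theorem mul_two_add_log_le {C C₆ : ℝ} (hC0 : 0 < C) (hC1 : C ≤ 1) (hC₆ : 1 ≤ C₆) :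
    C * (2 + Real.log (1 / (C₆ * C))) ≤ 4 * Real.sqrt C := by
  have hsqrt : 0 < Real.sqrt C := Real.sqrt_pos.2 hC0
  have hsq : Real.sqrt C * Real.sqrt C = C := Real.mul_self_sqrt hC0.le
  have hCsqrt : C ≤ Real.sqrt C := by
    have h1 : Real.sqrt C ≤ 1 := (Real.sqrt_le_sqrt hC1).trans_eq Real.sqrt_one
    calc C = Real.sqrt C * Real.sqrt C := hsq.symm
      _ ≤ Real.sqrt C * 1 := mul_le_mul_of_nonneg_left h1 hsqrt.le
      _ = Real.sqrt C := mul_one _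
  -- `log(1/(C₆C)) ≤ log(1/C) = 2 log(1/√C) ≤ 2 (1/√C - 1)`
  have h1 : Real.log (1 / (C₆ * C)) ≤ Real.log (1 / C) := by
    refine Real.log_le_log (by positivity) ?_
    rw [one_div_le_one_div (by positivity) hC0]
    nlinarith
  have h2 : Real.log (1 / C) ≤ 2 * (1 / Real.sqrt C - 1) := by
    have e : 1 / C = (1 / Real.sqrt C) ^ 2 := by
      rw [div_pow, one_pow, Real.sq_sqrt hC0.le]
    rw [e, Real.log_pow]
    push_cast
    have := Real.log_le_sub_one_of_pos (by positivity : 0 < 1 / Real.sqrt C)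
    linarith
  calc C * (2 + Real.log (1 / (C₆ * C))) ≤ C * (2 + 2 * (1 / Real.sqrt C - 1)) := by
        have : Real.log (1 / (C₆ * C)) ≤ 2 * (1 / Real.sqrt C - 1) := h1.trans h2
        nlinarith
    _ = 2 * (C / Real.sqrt C) := by ring
    _ = 2 * Real.sqrt C := by
        congr 1
        rw [div_eq_iff hsqrt.ne', hsq]
    _ ≤ 4 * Real.sqrt C := by linarith

/-- **The lower bound on the budget**: for `d ≥ 1`, `M ≥ 1`, `(M+1) s ≤ C₅` (`s = 1/(2d)`),
`0 < C₅`, `1 ≤ C₆`, `C₆ C₅ ≤ 1`: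
`(d/4) exp(-2C₅(2 + log(1/(C₆C₅))) d) ≤ ⅛ C₆^{M+1} (M+1)! s^M` (from `x! ≥ (x/e)^x` and
`negMulLog ≤ 1`). [folklore] -/
theorem budget_rhs_lower {C₅ C₆ : ℝ} (hC₅ : 0 < C₅) (hC₆ : 1 ≤ C₆) (hCC : C₆ * C₅ ≤ 1) (hd : 1 ≤ d)
    {M : ℕ} (hsM : ((M : ℝ) + 1) * (1 / (2 * (d : ℝ))) ≤ C₅) :
    (d : ℝ) / 4 * Real.exp (-(2 * C₅ * (2 + Real.log (1 / (C₆ * C₅)))) * d) ≤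
      1 / 8 * (C₆ ^ (M + 1) * ((M + 1).factorial : ℝ) * (1 / (2 * (d : ℝ))) ^ M) := by
  have hd0 : (0 : ℝ) < d := by exact_mod_cast (show 0 < d by omega)
  set s : ℝ := 1 / (2 * (d : ℝ)) with hs
  have hs0 : 0 < s := by rw [hs]; positivity
  set x : ℝ := (M : ℝ) + 1 with hx
  have hx0 : 0 < x := by rw [hx]; positivity
  have he : 0 < Real.exp 1 := Real.exp_pos 1
  -- `x! ≥ x^x e^{-x}`
  have hfact : x ^ (M + 1) / Real.exp 1 ^ (M + 1) ≤ ((M + 1).factorial : ℝ) := by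
    have h := Real.pow_div_factorial_le_exp x hx0.le (M + 1)
    rw [show (x : ℝ) = ((M + 1 : ℕ) : ℝ) * 1 by rw [hx]; push_cast; ring, Real.exp_nat_mul] at h
    rw [show ((M + 1 : ℕ) : ℝ) * 1 = x by rw [hx]; push_cast; ring] at h
    have hf : (0 : ℝ) < ((M + 1).factorial : ℝ) := by exact_mod_cast Nat.factorial_pos _
    rw [div_le_iff₀ hf] at h
    rw [div_le_iff₀ (by positivity)]
    linarith
  -- `t = C₆ x s / e`, `RHS ≥ (1/8)(1/s) t^{M+1}`
  set t : ℝ := C₆ * x * s / Real.exp 1 with ht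
  have ht0 : 0 < t := by rw [ht]; positivity
  have hlow : 1 / 8 * ((1 / s) * t ^ (M + 1)) ≤ 1 / 8 * (C₆ ^ (M + 1) * ((M + 1).factorial : ℝ) * s ^ M) := by
    refine mul_le_mul_of_nonneg_left ?_ (by norm_num)
    have e1 : (1 / s) * t ^ (M + 1) = C₆ ^ (M + 1) * (x ^ (M + 1) / Real.exp 1 ^ (M + 1)) * s ^ M := by
      rw [ht, div_pow, mul_pow, mul_pow, pow_succ s M]
      field_simp
    rw [e1]
    gcongr
  refine le_trans ?_ hlow
  -- `t^{M+1} = exp((M+1) log t) ≥ exp(-λ d)`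
  have hxs : x * s ≤ C₅ := hsM
  have hθ1 : x * s / C₅ ≤ 1 := by rw [div_le_one hC₅]; exact hxs
  have hθ0 : 0 < x * s / C₅ := by positivity
  have hlogt : Real.log t = Real.log (C₆ * C₅ / Real.exp 1) + Real.log (x * s / C₅) := by
    rw [← Real.log_mul (by positivity) hθ0.ne']
    congr 1
    rw [ht]; field_simp
  have hkey : -(2 * C₅ * (2 + Real.log (1 / (C₆ * C₅)))) * d ≤ (M + 1) * Real.log t := by
    -- `(M+1) log t = x log(C₆C₅/e) + x log θ`, `x = 2 d (x s)`, `θ = x s / C₅`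
    have hxd : x = 2 * d * (x * s) := by rw [hs]; field_simp
    have hl1 : Real.log (C₆ * C₅ / Real.exp 1) = Real.log (C₆ * C₅) - 1 := by
      rw [Real.log_div (by positivity) he.ne', Real.log_exp]
    have hl1' : Real.log (C₆ * C₅) - 1 ≤ 0 := by
      have : Real.log (C₆ * C₅) ≤ 0 := Real.log_nonpos (by positivity) hCC
      linarith
    have hl2 : Real.log (1 / (C₆ * C₅)) = -Real.log (C₆ * C₅) := by
      rw [one_div, Real.log_inv]
    -- `x log θ ≥ -2 d C₅` from `negMulLog θ ≤ 1 - θ ≤ 1`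
    have hneg : (x * s / C₅) * Real.log (x * s / C₅) ≥ -1 := by
      have h := Real.negMulLog_le_one_sub_self hθ0.le
      rw [Real.negMulLog] at h
      linarith
    have hM1 : ((M : ℕ) : ℝ) + 1 = x := by rw [hx]
    rw [show ((M : ℝ) + 1) = x from rfl, hlogt, hl1, hl2]
    -- goal: -(2C₅(2 - log(C₆C₅))) d ≤ x ((log(C₆C₅) - 1) + log θ)
    have hpart1 : 2 * d * C₅ * (Real.log (C₆ * C₅) - 1) ≤ x * (Real.log (C₆ * C₅) - 1) := by
      -- `x ≤ 2 d C₅` and the factor is `≤ 0`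
      have hx2 : x ≤ 2 * d * C₅ := by rw [hxd]; gcongr
      nlinarith
    have hpart2 : -(2 * d * C₅) ≤ x * Real.log (x * s / C₅) := by
      have e3 : 2 * (d : ℝ) * C₅ * ((x * s / C₅) * Real.log (x * s / C₅)) = x * Real.log (x * s / C₅) := by
        rw [hs]; field_simp
      rw [← e3]
      have h2d : 0 ≤ 2 * (d : ℝ) * C₅ := by positivity
      nlinarith [mul_le_mul_of_nonneg_left (show -1 ≤ (x * s / C₅) * Real.log (x * s / C₅) from hneg) h2d]
    nlinarith
  have htpow : Real.exp ((M + 1) * Real.log t) = t ^ (M + 1) := by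
    rw [show ((M : ℝ) + 1) = ((M + 1 : ℕ) : ℝ) by push_cast; ring, Real.exp_nat_mul, Real.exp_log ht0]
  calc (d : ℝ) / 4 * Real.exp (-(2 * C₅ * (2 + Real.log (1 / (C₆ * C₅)))) * d)
      ≤ (d : ℝ) / 4 * Real.exp ((M + 1) * Real.log t) := by gcongr
    _ = 1 / 8 * ((1 / s) * t ^ (M + 1)) := by rw [htpow, hs]; field_simp; ring

/-- **`τ_d` decays exponentially**: with `p = d/36864 - 1`, `K₀ = 512p` and `d ≥ 4·36864`,
`τ ≤ 144·96⁴·(4/3)⁵ · exp(-(log(4/3)/36864) d)`. [folklore] -/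
theorem tauLong_dim_le (hd4 : 36864 * 4 ≤ d) :
    tauLong (d / 36864 - 1) (512 * (d / 36864 - 1)) ≤
      144 * (96 : ℝ) ^ 4 * (4 / 3 : ℝ) ^ 5 * Real.exp (-(Real.log (4 / 3) / 36864) * d) := by
  have hq4 : 4 ≤ d / 36864 := (Nat.le_div_iff_mul_le (by norm_num)).2 (by omega)
  have hp3 : 3 ≤ d / 36864 - 1 := by omega
  have h1 := tauLong_le hp3
  have e1 : (3 / 4 : ℝ) ^ (d / 36864 - 4) = (4 / 3 : ℝ) ^ 4 * (3 / 4 : ℝ) ^ (d / 36864) := by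
    have : (3 / 4 : ℝ) ^ (d / 36864) = (3 / 4 : ℝ) ^ (d / 36864 - 4) * (3 / 4 : ℝ) ^ 4 := by
      rw [← pow_add]; congr 1; omega
    rw [this]; ring_nf
  have h2 : (3 / 4 : ℝ) ^ (d / 36864 - 1 - 3) ≤ (4 / 3 : ℝ) ^ 5 * Real.exp (-(Real.log (4 / 3) / 36864) * d) := by
    rw [show d / 36864 - 1 - 3 = d / 36864 - 4 by omega, e1]
    have h3 := three_quarters_pow_div_le d (q := 36864) (by norm_num)
    calc (4 / 3 : ℝ) ^ 4 * (3 / 4 : ℝ) ^ (d / 36864)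
        ≤ (4 / 3 : ℝ) ^ 4 * (4 / 3 * Real.exp (-(Real.log (4 / 3) / (36864 : ℕ)) * d)) :=
          mul_le_mul_of_nonneg_left h3 (by positivity)
      _ = (4 / 3 : ℝ) ^ 5 * Real.exp (-(Real.log (4 / 3) / 36864) * d) := by push_cast; ring
  calc tauLong (d / 36864 - 1) (512 * (d / 36864 - 1)) ≤ 144 * (96 : ℝ) ^ 4 * (3 / 4 : ℝ) ^ (d / 36864 - 1 - 3) := h1
    _ ≤ 144 * (96 : ℝ) ^ 4 * ((4 / 3 : ℝ) ^ 5 * Real.exp (-(Real.log (4 / 3) / 36864) * d)) :=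
        mul_le_mul_of_nonneg_left h2 (by positivity)
    _ = _ := by ring

/-- **The long-piece budget holds for all large `d`**: with `p = d/36864 - 1`, `K₀ = 512p`, for
admissible `C₅* ≪ 1 ≤ C₆` (`C₆ C₅* ≤ 1`, `16 √C₅* ≤ log(4/3)/36864`), eventually in `d`, for every
`0 < C₅ ≤ C₅*` and every `M ≥ 1` with `(M+1)s ≤ C₅`:
`4M(M+1) τ ≤ ⅛ C₆^{M+1}(M+1)! s^M`. [folklore] -/
theorem eventually_budget_long {C₅s C₆ : ℝ} (hC₅s : 0 < C₅s) (hC₅s1 : C₅s ≤ 1) (hC₆ : 1 ≤ C₆)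
    (hCC : C₆ * C₅s ≤ 1) (hlam0 : 8 * Real.sqrt C₅s ≤ Real.log (4 / 3) / 36864 / 2) :
    ∀ᶠ d : ℕ in atTop, ∀ C₅ : ℝ, 0 < C₅ → C₅ ≤ C₅s → ∀ M : ℕ, 1 ≤ M →
      ((M : ℝ) + 1) * (1 / (2 * (d : ℝ))) ≤ C₅ →
      4 * (M : ℝ) * (M + 1) * tauLong (d / 36864 - 1) (512 * (d / 36864 - 1)) ≤
        1 / 8 * (C₆ ^ (M + 1) * ((M + 1).factorial : ℝ) * (1 / (2 * (d : ℝ))) ^ M) := by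
  obtain ⟨c, hc⟩ : ∃ c : ℝ, c = Real.log (4 / 3) / 36864 := ⟨_, rfl⟩
  have hlog : 0 < Real.log (4 / 3) := Real.log_pos (by norm_num)
  have hc0 : 0 < c := by rw [hc]; positivity
  obtain ⟨Cτ, hCτ⟩ : ∃ Cτ : ℝ, Cτ = 144 * (96 : ℝ) ^ 4 := ⟨_, rfl⟩
  have hCτ0 : 0 ≤ Cτ := by rw [hCτ]; positivity
  obtain ⟨K, hK⟩ : ∃ K : ℝ, K = 64 * C₅s ^ 2 * Cτ * (4 / 3 : ℝ) ^ 5 := ⟨_, rfl⟩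
  -- `d e^{-(c/2) d} → 0`
  have htend : Tendsto (fun d : ℕ => K * ((d : ℝ) * Real.exp (-(c / 2) * d))) atTop (𝓝 0) := by
    have h1 := (Real.tendsto_pow_mul_exp_neg_atTop_nhds_zero 1).comp
      ((tendsto_natCast_atTop_atTop (R := ℝ)).const_mul_atTop (by positivity : 0 < c / 2))
    have h2 : (fun d : ℕ => K * ((d : ℝ) * Real.exp (-(c / 2) * d))) =
        fun d : ℕ => (K * (2 / c)) * (((fun x : ℝ => x ^ 1 * Real.exp (-x)) ∘ fun d : ℕ => c / 2 * (d : ℝ)) d) := by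
      funext d
      simp only [Function.comp, pow_one]
      rw [show -(c / 2 * (d : ℝ)) = -(c / 2) * d by ring]
      field_simp
    rw [h2, show (0 : ℝ) = (K * (2 / c)) * 0 by ring]
    exact h1.const_mul _
  have hev1 : ∀ᶠ d : ℕ in atTop, K * ((d : ℝ) * Real.exp (-(c / 2) * d)) ≤ 1 :=
    (htend.eventually (Iic_mem_nhds zero_lt_one)).mono fun d hd => hd
  filter_upwards [hev1, eventually_ge_atTop (36864 * 4)] with d hd1 hd4
  intro C₅ hC₅0 hC₅le M hM hsM
  have hd : 1 ≤ d := le_trans (by norm_num) hd4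
  have hd0 : (0 : ℝ) < d := by exact_mod_cast (show 0 < d by omega)
  -- `τ ≤ Cτ (4/3)^5 exp(-c d)`
  have hτ : tauLong (d / 36864 - 1) (512 * (d / 36864 - 1)) ≤ Cτ * (4 / 3 : ℝ) ^ 5 * Real.exp (-c * d) := by
    rw [hCτ, hc, show -(Real.log (4 / 3) / 36864) * (d : ℝ) = -(Real.log (4 / 3) / 36864) * d from rfl]
    exact tauLong_dim_le hd4
  -- `M + 1 ≤ 2 C₅ d`
  have hx : (M : ℝ) + 1 ≤ 2 * C₅ * d := by
    have := hsM
    rw [← mul_div_assoc, mul_one, div_le_iff₀ (by positivity)] at this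
    linarith
  -- the lower bound on the right side
  have hCC' : C₆ * C₅ ≤ 1 := le_trans (by gcongr) hCC
  have hrhs := budget_rhs_lower hC₅0 hC₆ hCC' hd hsM
  have hlam : 2 * C₅ * (2 + Real.log (1 / (C₆ * C₅))) ≤ c / 2 := by
    have h1 := mul_two_add_log_le hC₅0 (hC₅le.trans hC₅s1) hC₆
    have h2 : Real.sqrt C₅ ≤ Real.sqrt C₅s := Real.sqrt_le_sqrt hC₅le
    rw [hc]
    nlinarith
  have hexp : Real.exp (-(c / 2) * d) ≤ Real.exp (-(2 * C₅ * (2 + Real.log (1 / (C₆ * C₅)))) * d) :=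
    Real.exp_le_exp.2 (by nlinarith)
  -- chain
  have hτ0 := tauLong_nonneg (d / 36864 - 1) (512 * (d / 36864 - 1))
  calc 4 * (M : ℝ) * (M + 1) * tauLong (d / 36864 - 1) (512 * (d / 36864 - 1))
      ≤ 4 * ((M : ℝ) + 1) * (M + 1) * tauLong (d / 36864 - 1) (512 * (d / 36864 - 1)) := by
        gcongr; linarith
    _ ≤ 4 * (2 * C₅ * d) * (2 * C₅ * d) * (Cτ * (4 / 3 : ℝ) ^ 5 * Real.exp (-c * d)) := by
        gcongr
    _ ≤ 4 * (2 * C₅s * d) * (2 * C₅s * d) * (Cτ * (4 / 3 : ℝ) ^ 5 * Real.exp (-c * d)) := by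
        gcongr
    _ = (K * ((d : ℝ) * Real.exp (-(c / 2) * d))) * ((d : ℝ) / 4 * Real.exp (-(c / 2) * d)) := by
        rw [hK, show -c * (d : ℝ) = -(c / 2) * d + -(c / 2) * d by ring, Real.exp_add]
        ring
    _ ≤ 1 * ((d : ℝ) / 4 * Real.exp (-(c / 2) * d)) := by gcongr
    _ ≤ (d : ℝ) / 4 * Real.exp (-(2 * C₅ * (2 + Real.log (1 / (C₆ * C₅)))) * d) := by
        rw [one_mul]; gcongr
    _ ≤ _ := hrhs

/-! ### The induction (C8) -/

/-- `1 + x ≤ exp x` gives `(1 + C_b/d)^{K₀} ≤ exp(C_b/72)` for `72 K₀ ≤ d`. [folklore] -/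
theorem one_add_div_pow_le_exp {Cb : ℝ} (hCb : 0 ≤ Cb) {K₀ : ℕ} (hd : 1 ≤ d) (hK : 72 * K₀ ≤ d) :
    (1 + Cb / d) ^ K₀ ≤ Real.exp (Cb / 72) := by
  have hd0 : (0 : ℝ) < d := by exact_mod_cast (show 0 < d by omega)
  calc (1 + Cb / d) ^ K₀ ≤ Real.exp (Cb / d) ^ K₀ := by
        refine pow_le_pow_left₀ (by positivity) ?_ K₀
        have := Real.add_one_le_exp (Cb / d)
        linarith
    _ = Real.exp (Cb / d * K₀) := by rw [← Real.exp_nat_mul, mul_comm]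
    _ ≤ Real.exp (Cb / 72) := by
        refine Real.exp_le_exp.2 ?_
        rw [div_mul_eq_mul_div, div_le_div_iff₀ hd0 (by norm_num)]
        have : (72 : ℝ) * K₀ ≤ d := by exact_mod_cast hK
        nlinarith

set_option maxHeartbeats 400000 in
/-- **Graham's claim (C8) at infinite memory**: there are `C₅ > 0` and `C₆ ≥ 2` such that for all
`d ≥ 1` and `M ≥ 1` with `M s ≤ C₅` (`s = 1/(2d)`), `|z_c(d) - Σ_{n<M} αₙ sⁿ| ≤ C₆^M M! s^M`
(`αₙ = alpha grahamC n`). [cite: Graham2010, Section 6, eq. (C8)] -/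
theorem graham_induction :
    ∃ C₅ C₆ : ℝ, 0 < C₅ ∧ 2 ≤ C₆ ∧ ∀ d : ℕ, 1 ≤ d → ∀ M : ℕ, 1 ≤ M →
      (M : ℝ) * (1 / (2 * (d : ℝ))) ≤ C₅ →
      |criticalPoint d - ∑ n ∈ Finset.Ico 1 M, alpha grahamC n * (1 / (2 * (d : ℝ))) ^ n| ≤
        C₆ ^ M * (M.factorial : ℝ) * (1 / (2 * (d : ℝ))) ^ M := by
  obtain ⟨c₀, Cb, hc₀, hCb, hpack⟩ := exists_highDim_package
  obtain ⟨C₂', hC₂'0, hα'⟩ := Graham2010_lemma3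
  -- constants
  obtain ⟨C₂, hC₂⟩ : ∃ C₂ : ℝ, C₂ = max C₂' 1 := ⟨_, rfl⟩
  have hC₂1 : 1 ≤ C₂ := by rw [hC₂]; exact le_max_right _ _
  have hα : ∀ n, |alpha grahamC n| ≤ C₂ ^ n * (n.factorial : ℝ) := fun n =>
    (hα' n).trans (mul_le_mul_of_nonneg_right
      (pow_le_pow_left₀ hC₂'0.le (by rw [hC₂]; exact le_max_left _ _) n) (Nat.cast_nonneg _))
  obtain ⟨Γ₀, hΓ₀⟩ : ∃ Γ₀ : ℝ, Γ₀ = Real.exp (Cb / 72) := ⟨_, rfl⟩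
  have hΓ₀1 : 1 ≤ Γ₀ := by rw [hΓ₀]; exact Real.one_le_exp (by positivity)
  have hΓ₀0 : 0 ≤ Γ₀ := zero_le_one.trans hΓ₀1
  have he : 0 < Real.exp 1 := Real.exp_pos 1
  obtain ⟨C₆, hC₆⟩ : ∃ C₆ : ℝ, C₆ = 2 + 8 * 6912 * Γ₀ + 2 * c₀ + 8 * Real.exp 1 +
      Real.exp 1 * (46656 * C₂ ^ 2) + 82944 := ⟨_, rfl⟩
  have hC₆2 : 2 ≤ C₆ := by
    have : 0 ≤ 8 * 6912 * Γ₀ + 2 * c₀ + 8 * Real.exp 1 + Real.exp 1 * (46656 * C₂ ^ 2) + 82944 := by positivity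
    rw [hC₆]; linarith
  have hC₆1 : 1 ≤ C₆ := le_trans (by norm_num) hC₆2
  have hC₆a : 8 * 6912 * Γ₀ ≤ C₆ := by rw [hC₆]; nlinarith [sq_nonneg C₂]
  have hC₆b : 2 * c₀ ≤ C₆ := by rw [hC₆]; nlinarith [sq_nonneg C₂]
  have hC₆c : 8 * Real.exp 1 ≤ C₆ := by rw [hC₆]; nlinarith [sq_nonneg C₂]
  have hC₆d : Real.exp 1 * (46656 * C₂ ^ 2) ≤ C₆ := by rw [hC₆]; nlinarith [sq_nonneg C₂]
  have hC₆e : 82944 ≤ C₆ := by rw [hC₆]; nlinarith [sq_nonneg C₂]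
  obtain ⟨cτ, hcτ⟩ : ∃ cτ : ℝ, cτ = Real.log (4 / 3) / 36864 := ⟨_, rfl⟩
  have hcτ0 : 0 < cτ := by rw [hcτ]; exact div_pos (Real.log_pos (by norm_num)) (by norm_num)
  obtain ⟨D, hD⟩ : ∃ D : ℝ, D = 46656 * C₂ ^ 2 + 1152 * Γ₀ + 82944 + C₆ + (16 / cτ) ^ 2 + 1 := ⟨_, rfl⟩
  have hD0 : 0 < D := by rw [hD]; positivity
  obtain ⟨C₅s, hC₅s⟩ : ∃ C₅s : ℝ, C₅s = 1 / D := ⟨_, rfl⟩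
  have hC₅s0 : 0 < C₅s := by rw [hC₅s]; positivity
  have hle_of : ∀ x : ℝ, 0 < x → x ≤ D → C₅s ≤ 1 / x := fun x hx hxD => by
    rw [hC₅s]; exact one_div_le_one_div_of_le hx hxD
  have hD1 : C₅s * (46656 * C₂ ^ 2) ≤ 1 := by
    have := hle_of (46656 * C₂ ^ 2) (by positivity) (by rw [hD]; nlinarith [sq_nonneg (16 / cτ)])
    rwa [le_div_iff₀ (by positivity)] at this
  have hD2 : C₅s * (1152 * Γ₀) ≤ 1 := by
    have := hle_of (1152 * Γ₀) (by positivity) (by rw [hD]; nlinarith [sq_nonneg (16 / cτ), sq_nonneg C₂])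
    rwa [le_div_iff₀ (by positivity)] at this
  have hD3 : C₅s * 82944 ≤ 1 := by
    have := hle_of 82944 (by norm_num) (by rw [hD]; nlinarith [sq_nonneg (16 / cτ), sq_nonneg C₂])
    rwa [le_div_iff₀ (by positivity)] at this
  have hD4 : C₅s * C₆ ≤ 1 := by
    have := hle_of C₆ (by positivity) (by rw [hD]; nlinarith [sq_nonneg (16 / cτ), sq_nonneg C₂])
    rwa [le_div_iff₀ (by positivity)] at this
  have hD5 : C₅s ≤ 1 := by
    have := hle_of 1 one_pos (by rw [hD]; nlinarith [sq_nonneg (16 / cτ), sq_nonneg C₂])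
    simpa using this
  have hD6 : 8 * Real.sqrt C₅s ≤ cτ / 2 := by
    have h1 : C₅s ≤ 1 / (16 / cτ) ^ 2 :=
      hle_of ((16 / cτ) ^ 2) (by positivity) (by rw [hD]; nlinarith [sq_nonneg C₂])
    have h2 : Real.sqrt C₅s ≤ cτ / 16 := by
      rw [Real.sqrt_le_left (by positivity)]
      refine h1.trans (le_of_eq ?_)
      field_simp
    linarith
  -- eventual facts
  have hbudget := eventually_budget_long hC₅s0 hD5 hC₆1 (by linarith [hD4]) (by rw [hcτ] at hD6; exact hD6)
  have hexp0 : Tendsto (fun d : ℕ => 144 * (96 : ℝ) ^ 4 * (4 / 3 : ℝ) ^ 5 * Real.exp (-(Real.log (4 / 3) / 36864) * d))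
      atTop (𝓝 0) := by
    have h1 : Tendsto (fun d : ℕ => -(Real.log (4 / 3) / 36864) * (d : ℝ)) atTop atBot := by
      have : -(Real.log (4 / 3) / 36864) < 0 := by rw [← hcτ]; linarith
      exact (tendsto_natCast_atTop_atTop (R := ℝ)).const_mul_atTop_of_neg this
    have h2 := Real.tendsto_exp_atBot.comp h1
    simpa using h2.const_mul (144 * (96 : ℝ) ^ 4 * (4 / 3 : ℝ) ^ 5)
  have hevτ : ∀ᶠ d : ℕ in atTop, tauLong (d / 36864 - 1) (512 * (d / 36864 - 1)) ≤ 1 / 2 := by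
    filter_upwards [hexp0.eventually (Iic_mem_nhds (by norm_num : (0 : ℝ) < 1 / 2)), eventually_ge_atTop (36864 * 4)]
      with d hd hd4
    exact (tauLong_dim_le hd4).trans hd
  have hevs : ∀ᶠ d : ℕ in atTop, 576 * Γ₀ * (1 / (2 * (d : ℝ))) ≤ 1 / 2 := by
    have : Tendsto (fun d : ℕ => 576 * Γ₀ * (1 / (2 * (d : ℝ)))) atTop (𝓝 0) := by
      have h := (tendsto_const_nhds (x := (576 * Γ₀ / 2 : ℝ))).div_atTop (tendsto_natCast_atTop_atTop (R := ℝ))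
      refine h.congr' (Eventually.of_forall fun d => ?_)
      simp only; ring
    exact (this.eventually (Iic_mem_nhds (by norm_num : (0 : ℝ) < 1 / 2))).mono fun d hd => hd
  obtain ⟨d₁, hd₁⟩ := Filter.eventually_atTop.1 (hpack.and (hbudget.and (hevτ.and (hevs.and
    (eventually_ge_atTop (36864 * 5))))))
  -- the final `C₅`
  obtain ⟨C₅, hC₅⟩ : ∃ C₅ : ℝ, C₅ = min C₅s (1 / (2 * ((max d₁ 1 : ℕ) : ℝ))) := ⟨_, rfl⟩
  have hC₅0 : 0 < C₅ := by rw [hC₅]; exact lt_min hC₅s0 (by positivity)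
  have hC₅le : C₅ ≤ C₅s := by rw [hC₅]; exact min_le_left _ _
  refine ⟨C₅, C₆, hC₅0, hC₆2, fun d hd => ?_⟩
  have hd0 : (0 : ℝ) < d := by exact_mod_cast (show 0 < d by omega)
  haveI : NeZero d := ⟨by omega⟩
  set s : ℝ := 1 / (2 * (d : ℝ)) with hs
  have hs0 : 0 < s := by rw [hs]; positivity
  -- if `s ≤ C₅` then `d ≥ d₁` and all the eventual facts hold at `d`
  have hgood : s ≤ C₅ → d₁ ≤ d := by
    intro hsC
    have h1 : s ≤ 1 / (2 * ((max d₁ 1 : ℕ) : ℝ)) := hsC.trans (by rw [hC₅]; exact min_le_right _ _)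
    rw [hs, one_div_le_one_div (by positivity) (by positivity)] at h1
    have : ((max d₁ 1 : ℕ) : ℝ) ≤ d := by linarith
    have : max d₁ 1 ≤ d := by exact_mod_cast this
    exact le_trans (le_max_left _ _) this
  intro M hM
  induction M, hM using Nat.le_induction with
  | base =>
    intro _
    rw [Finset.Ico_self, Finset.sum_empty, sub_zero, abs_of_pos (criticalPoint_pos d), pow_one, pow_one,
      Nat.factorial_one, Nat.cast_one, mul_one]
    have h2 := two_mul_natCast_mul_criticalPoint_le_two hd
    -- `z_c ≤ 1/d = 2 s ≤ C₆ s`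
    have : criticalPoint d ≤ 2 * s := by
      rw [hs]; rw [show 2 * (1 / (2 * (d : ℝ))) = 1 / d by field_simp, le_div_iff₀ hd0]; linarith
    exact this.trans (mul_le_mul_of_nonneg_right hC₆2 hs0.le)
  | succ M hM IH =>
    intro hsM
    push_cast at hsM
    have hM0 : (0 : ℝ) ≤ M := Nat.cast_nonneg M
    have hsM' : (M : ℝ) * s ≤ C₅ := (mul_le_mul_of_nonneg_right (by linarith) hs0.le).trans hsM
    have hIH := IH hsM'
    have hsC : s ≤ C₅ := (le_mul_of_one_le_left hs0.le (by linarith)).trans hsM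
    obtain ⟨⟨-, hr4, htype, hzcb, hbootz⟩, hbud, hτd, hsd, hd5⟩ := hd₁ d (hgood hsC)
    have hq5 : 5 ≤ d / 36864 := (Nat.le_div_iff_mul_le (by norm_num)).2 (by omega)
    have hqd : 36864 * (d / 36864) ≤ d := Nat.mul_div_le d 36864
    set p := d / 36864 - 1 with hp
    have hp4 : 4 ≤ p := by omega
    have hd6 : 6 * (p + 1) + 1 ≤ d := by omega
    have hK₀ : 2 * p + 2 ≤ 512 * p := by omega
    have h72 : 72 * (512 * p) ≤ d := by omega
    have hratio : 144 * (((512 * p : ℕ) : ℝ) + 2) * (1 / (2 * (d : ℝ))) ≤ 1 := by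
      have h1 : 72 * (512 * p + 2) ≤ d := by omega
      have h2 : (72 : ℝ) * (512 * p + 2) ≤ d := by exact_mod_cast h1
      rw [← mul_div_assoc, mul_one, div_le_one (by positivity)]
      push_cast at h2 ⊢
      linarith
    have hΓ : (1 + Cb / d) ^ (512 * p) ≤ Γ₀ := by rw [hΓ₀]; exact one_add_div_pow_le_exp hCb.le hd h72
    have hW : 576 * Γ₀ * (1 / (2 * (d : ℝ))) + tauLong p (512 * p) ≤ 1 := by rw [hp]; linarith
    have hd16 : 1 / (2 * (d : ℝ)) ≤ 1 / 16 := by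
      rw [one_div_le_one_div (by positivity) (by norm_num)]
      have : (8 : ℝ) ≤ d := by exact_mod_cast (show 8 ≤ d by omega)
      linarith
    have hsM1 : ((M : ℝ) + 1) * (1 / (2 * (d : ℝ))) ≤ C₅ := hsM
    have hτM := hbud C₅ hC₅0 hC₅le M hM hsM1
    have hC₅κ : 46656 * C₂ ^ 2 * C₅ ≤ 1 := by
      calc 46656 * C₂ ^ 2 * C₅ ≤ 46656 * C₂ ^ 2 * C₅s := by gcongr
        _ = C₅s * (46656 * C₂ ^ 2) := by ring
        _ ≤ 1 := hD1
    have hC₅Γ : 1152 * Γ₀ * C₅ ≤ 1 := by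
      calc 1152 * Γ₀ * C₅ ≤ 1152 * Γ₀ * C₅s := by gcongr
        _ = C₅s * (1152 * Γ₀) := by ring
        _ ≤ 1 := hD2
    have hC₅c : 82944 * C₅ ≤ 1 := by
      calc (82944 : ℝ) * C₅ ≤ 82944 * C₅s := by gcongr
        _ = C₅s * 82944 := by ring
        _ ≤ 1 := hD3
    exact graham_step hd hc₀ hr4 htype hCb.le hzcb hbootz hp4 hd6 hK₀ hΓ hratio hW hC₂1 hα
      hC₅κ hC₅Γ hC₅c hC₆a hC₆b hC₆c hC₆d hC₆e hd16 hM hsM1 hτM hIH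

/-! ### The trivial regime `M s > C₅` and the theorem -/

/-- `M^M ≤ e^M M!`. [folklore] -/
theorem pow_self_le_exp_mul_factorial (M : ℕ) : (M : ℝ) ^ M ≤ Real.exp 1 ^ M * (M.factorial : ℝ) := by
  have h := Real.pow_div_factorial_le_exp (M : ℝ) (Nat.cast_nonneg M) M
  rw [show ((M : ℝ)) = ((M : ℕ) : ℝ) * 1 by ring, Real.exp_nat_mul] at h
  simp only [mul_one] at h
  have hf : (0 : ℝ) < (M.factorial : ℝ) := by exact_mod_cast Nat.factorial_pos M
  rwa [div_le_iff₀ hf] at h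

/-- **The trivial regime** ("for `s ≥ C₅/M`, inequality (SAWboundEqn) holds simply by Lemma 3"):
if `|αₙ| ≤ C₂ⁿ n!` (`C₂ ≥ 1`), `0 < C₅` and `C₅ < M s` (`s = 1/(2d)`, `d ≥ 1`), then
`|z_c - Σ_{n<M} αₙ sⁿ| ≤ (2e C₂ max(1/C₅,1))^M M! s^M`. [cite: Graham2010, Section 6] -/
theorem graham_trivial {C₂ C₅ : ℝ} (hC₂ : 1 ≤ C₂) (hα : ∀ n, |alpha grahamC n| ≤ C₂ ^ n * (n.factorial : ℝ))
    (hC₅ : 0 < C₅) (hd : 1 ≤ d) {M : ℕ} (hM : 1 ≤ M) (hMs : C₅ < (M : ℝ) * (1 / (2 * (d : ℝ)))) :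
    |criticalPoint d - ∑ n ∈ Finset.Ico 1 M, alpha grahamC n * (1 / (2 * (d : ℝ))) ^ n| ≤
      (2 * Real.exp 1 * C₂ * max (1 / C₅) 1) ^ M * (M.factorial : ℝ) * (1 / (2 * (d : ℝ))) ^ M := by
  have hd0 : (0 : ℝ) < d := by exact_mod_cast (show 0 < d by omega)
  haveI : NeZero d := ⟨by omega⟩
  obtain ⟨s, hs⟩ : ∃ s : ℝ, s = 1 / (2 * (d : ℝ)) := ⟨_, rfl⟩
  rw [← hs] at hMs ⊢
  have hs0 : 0 < s := by rw [hs]; positivity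
  set L : ℝ := max (1 / C₅) 1 with hL
  have hL1 : 1 ≤ L := le_max_right _ _
  have hLC : 1 / C₅ ≤ L := le_max_left _ _
  have he1 : 1 ≤ Real.exp 1 := Real.one_le_exp zero_le_one
  have hM0 : (1 : ℝ) ≤ M := by exact_mod_cast hM
  -- `1/s ≤ M L`
  have hinv : 1 / s ≤ M * L := by
    have h1 : 1 / s < M / C₅ := by
      rw [div_lt_div_iff₀ hs0 hC₅]; linarith
    have h2 : (M : ℝ) / C₅ ≤ M * L := by rw [div_eq_mul_one_div]; gcongr
    linarith
  have hinv0 : 0 ≤ 1 / s := by positivity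
  -- the common bound `B^M M! s^M` with `B = e C₂ L`
  set B : ℝ := Real.exp 1 * C₂ * L with hB
  have hB1 : 1 ≤ B := by
    rw [hB]; calc (1 : ℝ) = 1 * 1 * 1 := by ring
      _ ≤ Real.exp 1 * C₂ * L := by gcongr
  have hfac : (0 : ℝ) < (M.factorial : ℝ) := by exact_mod_cast Nat.factorial_pos M
  have hMM := pow_self_le_exp_mul_factorial M
  -- each `αₙ sⁿ` term
  have hterm : ∀ n ∈ Finset.Ico 1 M, |alpha grahamC n * s ^ n| ≤ B ^ M * (M.factorial : ℝ) * s ^ M := by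
    intro n hn
    rw [Finset.mem_Ico] at hn
    rw [abs_mul, abs_pow, abs_of_pos hs0]
    -- `s^n = s^M (1/s)^{M-n} ≤ s^M (ML)^{M-n}`
    have hsn : s ^ n = s ^ M * (1 / s) ^ (M - n) := by
      rw [one_div, inv_pow, ← div_eq_mul_inv, eq_div_iff (pow_ne_zero _ hs0.ne'), ← pow_add]
      congr 1; omega
    have hnfac : (n.factorial : ℝ) ≤ (M : ℝ) ^ n := by
      calc (n.factorial : ℝ) ≤ (n : ℝ) ^ n := by exact_mod_cast Nat.factorial_le_pow n
        _ ≤ (M : ℝ) ^ n := pow_le_pow_left₀ (Nat.cast_nonneg n) (by exact_mod_cast hn.2.le) n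
    calc |alpha grahamC n| * s ^ n ≤ C₂ ^ n * (n.factorial : ℝ) * (s ^ M * (1 / s) ^ (M - n)) := by
          rw [← hsn]; exact mul_le_mul_of_nonneg_right (hα n) (by positivity)
      _ ≤ C₂ ^ n * (M : ℝ) ^ n * (s ^ M * ((M : ℝ) * L) ^ (M - n)) := by gcongr
      _ = C₂ ^ n * L ^ (M - n) * (M : ℝ) ^ M * s ^ M := by
          rw [mul_pow, show (M : ℝ) ^ M = (M : ℝ) ^ n * (M : ℝ) ^ (M - n) by rw [← pow_add]; congr 1; omega]
          ring
      _ ≤ C₂ ^ M * L ^ M * (Real.exp 1 ^ M * (M.factorial : ℝ)) * s ^ M := by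
          have h1 : C₂ ^ n ≤ C₂ ^ M := pow_le_pow_right₀ hC₂ hn.2.le
          have h2 : L ^ (M - n) ≤ L ^ M := pow_le_pow_right₀ hL1 (Nat.sub_le M n)
          refine mul_le_mul_of_nonneg_right ?_ (pow_nonneg hs0.le M)
          exact mul_le_mul (mul_le_mul h1 h2 (by positivity) (by positivity)) hMM (by positivity) (by positivity)
      _ = B ^ M * (M.factorial : ℝ) * s ^ M := by rw [hB, mul_pow, mul_pow]; ring
  -- the `z_c` term: `z_c ≤ 2 s ≤ 2 B^M M! s^M`
  have hβ : |criticalPoint d| ≤ 2 * (B ^ M * (M.factorial : ℝ) * s ^ M) := by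
    rw [abs_of_pos (criticalPoint_pos d)]
    have h2 := two_mul_natCast_mul_criticalPoint_le_two hd
    have hzs : criticalPoint d ≤ 2 * s := by
      rw [hs, show 2 * (1 / (2 * (d : ℝ))) = 1 / d by field_simp, le_div_iff₀ hd0]; linarith
    -- `s = s^M (1/s)^{M-1} ≤ s^M (ML)^{M-1} ≤ s^M M^M L^M ≤ B^M M! s^M`
    have hs1 : s = s ^ M * (1 / s) ^ (M - 1) := by
      rw [one_div, inv_pow, ← div_eq_mul_inv, eq_div_iff (pow_ne_zero _ hs0.ne'), ← pow_succ']
      congr 1; omega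
    have hsle : s ≤ B ^ M * (M.factorial : ℝ) * s ^ M := by
      calc s = s ^ M * (1 / s) ^ (M - 1) := hs1
        _ ≤ s ^ M * ((M : ℝ) * L) ^ (M - 1) := by gcongr
        _ ≤ s ^ M * ((M : ℝ) * L) ^ M := by
            refine mul_le_mul_of_nonneg_left (pow_le_pow_right₀ ?_ (Nat.sub_le M 1)) (by positivity)
            nlinarith
        _ = (M : ℝ) ^ M * L ^ M * s ^ M := by rw [mul_pow]; ring
        _ ≤ (Real.exp 1 ^ M * (M.factorial : ℝ)) * (C₂ ^ M * L ^ M) * s ^ M := by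
            have hC : L ^ M ≤ C₂ ^ M * L ^ M := le_mul_of_one_le_left (by positivity) (one_le_pow₀ hC₂)
            have : (M : ℝ) ^ M * L ^ M ≤ (Real.exp 1 ^ M * (M.factorial : ℝ)) * (C₂ ^ M * L ^ M) :=
              mul_le_mul hMM hC (by positivity) (by positivity)
            exact mul_le_mul_of_nonneg_right this (by positivity)
        _ = B ^ M * (M.factorial : ℝ) * s ^ M := by rw [hB, mul_pow, mul_pow]; ring
    linarith
  -- assemble: `(M - 1 + 2) B^M M! s^M ≤ (M+1) B^M M! s^M ≤ (2B)^M M! s^M`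
  have hcount : ((Finset.Ico 1 M).card : ℝ) = M - 1 := by
    rw [Nat.card_Ico, Nat.cast_sub hM]; simp
  have hX0 : 0 ≤ B ^ M * (M.factorial : ℝ) * s ^ M := by positivity
  have h2M : (M : ℝ) + 1 ≤ 2 ^ M := by
    have : (M + 1 : ℕ) ≤ 2 ^ M := Nat.succ_le_of_lt (Nat.lt_two_pow_self)
    exact_mod_cast this
  calc |criticalPoint d - ∑ n ∈ Finset.Ico 1 M, alpha grahamC n * s ^ n|
      ≤ |criticalPoint d| + ∑ n ∈ Finset.Ico 1 M, |alpha grahamC n * s ^ n| :=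
        (abs_sub _ _).trans (add_le_add le_rfl (Finset.abs_sum_le_sum_abs _ _))
    _ ≤ 2 * (B ^ M * (M.factorial : ℝ) * s ^ M) + ∑ _n ∈ Finset.Ico 1 M, B ^ M * (M.factorial : ℝ) * s ^ M :=
        add_le_add hβ (Finset.sum_le_sum hterm)
    _ = ((M : ℝ) + 1) * (B ^ M * (M.factorial : ℝ) * s ^ M) := by
        rw [Finset.sum_const, nsmul_eq_mul, hcount]; ring
    _ ≤ (2 : ℝ) ^ M * (B ^ M * (M.factorial : ℝ) * s ^ M) := mul_le_mul_of_nonneg_right h2M hX0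
    _ = (2 * Real.exp 1 * C₂ * L) ^ M * (M.factorial : ℝ) * s ^ M := by
        rw [hB, mul_pow, mul_pow, mul_pow, mul_pow, mul_pow]; ring

/-- **Graham 2010, Theorem 1 at infinite memory, in the form of the series**: there are `C` and the
sequence `α = alpha grahamC` such that for all `M, d ≥ 1`,
`|z_c(d) - Σ_{n<M} αₙ (2d)^{-n}| ≤ C^M M! (2d)^{-M}`. [cite: Graham2010, Theorem 1] -/
theorem graham_theorem1 :
    ∃ C : ℝ, ∀ M d : ℕ, 1 ≤ M → 1 ≤ d →
      |criticalPoint d - ∑ n ∈ Finset.Ico 1 M, alpha grahamC n * (1 / (2 * (d : ℝ))) ^ n| ≤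
        C ^ M * (M.factorial : ℝ) * (1 / (2 * (d : ℝ))) ^ M := by
  obtain ⟨C₅, C₆, hC₅, hC₆, hind⟩ := graham_induction
  obtain ⟨C₂', hC₂'0, hα'⟩ := Graham2010_lemma3
  set C₂ : ℝ := max C₂' 1 with hC₂
  have hC₂1 : 1 ≤ C₂ := le_max_right _ _
  have hα : ∀ n, |alpha grahamC n| ≤ C₂ ^ n * (n.factorial : ℝ) := fun n =>
    (hα' n).trans (mul_le_mul_of_nonneg_right (pow_le_pow_left₀ hC₂'0.le (le_max_left _ _) n) (Nat.cast_nonneg _))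
  set B : ℝ := 2 * Real.exp 1 * C₂ * max (1 / C₅) 1 with hB
  refine ⟨max C₆ B, fun M d hM hd => ?_⟩
  have hd0 : (0 : ℝ) < d := by exact_mod_cast (show 0 < d by omega)
  have hs0 : 0 < 1 / (2 * (d : ℝ)) := by positivity
  have hC₂0 : 0 < C₂ := lt_of_lt_of_le one_pos hC₂1
  have hB0 : 0 ≤ B := mul_nonneg (mul_nonneg (mul_nonneg (by norm_num) (Real.exp_pos 1).le) hC₂0.le)
    (le_trans zero_le_one (le_max_right _ _))
  have hC₆0 : 0 ≤ C₆ := le_trans (by norm_num) hC₆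
  rcases le_or_gt ((M : ℝ) * (1 / (2 * (d : ℝ)))) C₅ with hle | hgt
  · refine (hind d hd M hM hle).trans ?_
    exact mul_le_mul_of_nonneg_right (mul_le_mul_of_nonneg_right
      (pow_le_pow_left₀ hC₆0 (le_max_left _ _) M) (Nat.cast_nonneg _)) (pow_nonneg hs0.le M)
  · refine (graham_trivial hC₂1 hα hC₅ hd hM hgt).trans ?_
    exact mul_le_mul_of_nonneg_right (mul_le_mul_of_nonneg_right
      (pow_le_pow_left₀ hB0 (le_max_right _ _) M) (Nat.cast_nonneg _)) (pow_nonneg hs0.le M)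

end Graham2010

/-- **BDGS 2012, eq. (1.20) = Graham 2010, Theorem 1**: there are constants `αᵢ` (here the
coefficients `alpha grahamC` of the reversion of Graham's fixed-point identity) and `C` such that
for all `M ≥ 1` and `d ≥ 1`, `|z_c - Σ_{i=1}^{M-1} αᵢ/(2d)^i| ≤ C^M M!/(2d)^M`. Proved at infinite
memory from the converged lace expansion (Slade 2006, Theorem 5.1, via the tree) — the source's
finite-memory route through Kesten's bound on `|μ - μ_τ|` is not needed.
[cite: BDGS2012, §1.4, eq. (1.20)] [cite: Graham2010, Theorem 1] -/
theorem BDGS2012_Graham_criticalPoint_bound_holds : BDGS2012_Graham_criticalPoint_bound := by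
  obtain ⟨C, hC⟩ := Graham2010.graham_theorem1
  refine ⟨Graham2010.alpha Graham2010.grahamC, C, fun M d hM hd => ?_⟩
  have h := hC M d hM hd
  have e1 : ∀ i : ℕ, Graham2010.alpha Graham2010.grahamC i / (2 * (d : ℝ)) ^ i =
      Graham2010.alpha Graham2010.grahamC i * (1 / (2 * (d : ℝ))) ^ i := fun i => by
    rw [one_div_pow, div_eq_mul_one_div]
  have e2 : C ^ M * (M.factorial : ℝ) / (2 * (d : ℝ)) ^ M = C ^ M * (M.factorial : ℝ) * (1 / (2 * (d : ℝ))) ^ M := by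
    rw [one_div_pow, div_eq_mul_one_div]
  simp_rw [e1, e2]
  exact h

end Literature.Probability.RandomPlanarGeometry.SAW.Zd
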